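import Literature.Geometry.Lorentzian.ADMTailCoefficientClass
import Literature.Geometry.Lorentzian.QuasiFinalAnalytic
import Literature.Geometry.Lorentzian.QuasiFinalCollarControl
import Literature.Geometry.Lorentzian.ExteriorTailHolderDecay
import Mathlib.Analysis.InnerProductSpace.Calculus
import Mathlib.Analysis.InnerProductSpace.Dual
import Mathlib.Analysis.Calculus.IteratedDeriv.Lemmas
import Mathlib.Analysis.Calculus.Deriv.Mul
import Mathlib.Analysis.Calculus.Deriv.Inv
import Mathlib.Analysis.Calculus.Deriv.ZPow
import Mathlib.Analysis.SpecialFunctions.ExpDeriv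
import Mathlib.Analysis.SpecialFunctions.Pow.Deriv
import HarnessLib

/-!
# The tail coefficient classes `𝒞𝒮_{-τ}`, `𝒞𝒮♯_{-τ}` of Ellithy 2026 are inhabited — flat and Schwarzschild tails

A. Ellithy, *The spacetime Penrose inequality under a quasi final state hypothesis*, arXiv:2605.18730
(bib key `Ellithy2026`).  The coefficient classes `𝒞𝒮_{-τ}(ℳ_{T̲,r₀})` [cite: Ellithy2026, Def. 3.6, p. 21]
and `𝒞𝒮♯_{-τ}(ℳ_{T̲,r₀})` [cite: Ellithy2026, Def. 3.8, p. 22] are typed in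
`Literature.Geometry.Lorentzian.ADMTailCoefficientClass` as `ADMTailTuple.IsTailCoeff` /
`ADMTailTuple.IsSharpTailCoeff` — conjunctions of some forty analytic clauses (weighted parabolic Hölder
norms valued `⊤` off their differentiability guards, tail nondegeneracy Def. 3.6 (ii), the finite
forcing tails Def. 3.6 (iii)); the rest-frame clause of §4.1 [cite: Ellithy2026, §4.1, p. 38] is
`ADMTailTuple.IsRestFrame` (`Literature.Geometry.Lorentzian.QuasiFinalAnalytic`).  No theorem of the
tree stated that these classes have an element.  This module exhibits elements WITH COMPUTED (not
defaulted) norms, and records the mass threshold of the decay window: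

* `flat_isTailCoeff`, `flat_isSharpTailCoeff`, `exists_isSharpTailCoeff` : the Minkowski tuple
  `(N, λ, β, b, γ) = (1, 1, 0, 0, r² γ_{S²})` (flat space in the foliation `t = const`, `r = |y|`) lies in
  `𝒞𝒮_{-τ}` and `𝒞𝒮♯_{-τ}` for every `r₀ ≥ 0` and ALL `α, τ, T̲` (all its norms vanish; `δ = ϑ = 1`,
  `r H = 2`, `Ξ ≡ 0`); the classes are non-empty.
* `radial f g` : the static spherically symmetric family `N = f(r)`, `λ = g(r)`, `β = b = 0`,
  `γ = r² γ_{S²}`; `radial_isTailNondegenerate`, `radial_hasFiniteForcingTail` (its forcing vanishes: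
  `K_t ≡ 0`), `radial_isRestFrame` (zero ADM momentum flux on every slice, the rest-frame clause of
  §4.1 p. 38).
* `schw m := radial (1 - m/r) (1 + m/r)` — the Schwarzschild exterior tail of mass `m` to first order in
  `m/r` (the `O(m/r)` truncation of `N = (1 - 2m/r)^{1/2}`, `λ = (1 - 2m/r)^{-1/2}` in the areal gauge):
  `schw_isTailCoeff`, `schw_isSharpTailCoeff` for `0 < r₀`, `2|m| ≤ r₀`, `0 < α ≤ 2` and every `τ ≤ 1`
  (weighted profiles `∓ m r^{τ-1}`; the parabolic Hölder quotients are controlled by the mean value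
  theorem in `s = log r`, `tailHolderSeminorm_pconst_le`), and `schw_restFrameTuple` : for
  `α ∈ (0,1)`, `τ ∈ (1/2,1)` — the window of the quasi final state hypothesis
  [cite: Ellithy2026, Def. 4.4, p. 39] — `schw m` satisfies `IsSharpTailCoeff ∧ IsRestFrame`.  This is
  the tuple-level content of the paper's remark that "the stationary Kerr and Schwarzschild exteriors
  are compatible with the final-state hypotheses after [a] harmless late-time gauge adjustment"
  [cite: Ellithy2026, Remark 4.6, p. 40] (to first order in `m/r`; the development-level clause
  `HasADMForm`, i.e. an actual horizon-penetrating chart of the Schwarzschild spacetime as in the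
  paper's appendix model, is NOT addressed here).
* `schw_not_isTailCoeff` : for `τ > 1` and `m ≠ 0` the same tuple is NOT in `𝒞𝒮_{-τ}` (`𝒩_τ = ∞`,
  `tailSupNorm_weighted_inv_eq_top`): the decay window `τ ∈ (1/2, 1)` of Def. 4.4 is exactly compatible
  with a positive ADM mass, and `τ = 1` is the sharp threshold of the class for static tails.

* `minkowski_isQuasiFinalAnalytic`, `minkowski_isQuasiFinalAnalyticCollar` (§14) : Minkowski space
  `(ℝ × E3, η)` with the polar late chart `Φ(t, r, p) = (t, r p)` and the flat tuple satisfies the typed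
  analytic predicate `IsQuasiFinalAnalytic` of Def. 4.4 (1)+(2) + §4.1 (`QuasiFinalAnalytic`) and the
  collar sentence (`QuasiFinalCollarControl`) for every `r₀ > 0`, `T̲` — the non-vacuity certificate of
  the assembled predicate (`HasADMForm` by the identity `(t, |y| · y/|y|) = (t, y)`, gauge reducibility
  from `β^⊥ = 0`, forcing decay from `Ξ ≡ 0`).

* `ctNorm_profile_lt_top`, `ctSharpNorm_profile_lt_top`, `radial_isSharpTailCoeff_of_profile` (§15) :
  the GENERIC static radial profile lemmas behind §10–§11 — an angle-independent profile `u(r)` with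
  `‖r^{σ+ℓ} ∂_r^ℓ u‖ ≤ B` on `r > r₁ > 0` for `ℓ ≤ 2` (resp. `ℓ ≤ 4`) has finite `C^{2+α,1+α/2}_{-σ}`
  (resp. `C^{2+α,1+α/2,♯}_{-σ}`) norm (`0 < α ≤ 2`; Hölder quotients by the mean value theorem in
  `s = log r`, `norm_rpow_smul_sub_le`), and `radial f g ∈ 𝒞𝒮♯_{-τ}` whenever `f - 1`, `g - 1` have such
  bounds to order `4` with weight `τ` and `f`, `g` are pinched between positive constants.

All statements are about the Literature definitions only (coefficient tuples and the flat model, not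
black-hole solutions).
Provenance: decomp-fsc lens-5 g32 support file `TailClassInhabited.lean` (statements and proofs
verbatim, re-homed into `namespace Literature.Geometry.Lorentzian.TailClassModel`; the cell-local summary
`schw_doorTuple` is renamed `schw_restFrameTuple`).  Typing a model proves nothing about any summit.
-/

noncomputable section

-- `E3 →L[ℝ] E3 →L[ℝ] ℝ`-valued `sub_self` / `smul` lemmas need one more pending-instance level to synthesise
-- (`ContinuousLinearMap` codomain instances); elaboration option only, no semantic effect.
set_option maxSynthPendingDepth 3

open Set Metric Function MeasureTheory Filter
open scoped ENNReal NNReal Topology RealInnerProductSpace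
open Literature.Geometry.Lorentzian

namespace Literature.Geometry.Lorentzian.TailClassModel

/-! ## §1 Unit-sphere algebra and the flat tuple -/

/-- Helper (`norm_coe_sphere`). [folklore] -/
private theorem norm_coe_sphere (p : sphere (0 : E3) 1) : ‖(p : E3)‖ = 1 := by simp

/-- Helper (`coe_sphere_ne_zero`). [folklore] -/
private theorem coe_sphere_ne_zero (p : sphere (0 : E3) 1) : (p : E3) ≠ 0 := by
  intro h; have := norm_coe_sphere p; rw [h, norm_zero] at this; exact zero_ne_one this

/-- Helper (`inner_self_sphere`). [folklore] -/
private theorem inner_self_sphere (p : sphere (0 : E3) 1) : ⟪(p : E3), (p : E3)⟫ = 1 := by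
  rw [real_inner_self_eq_norm_sq, norm_coe_sphere, one_pow]

/-- Helper (`sphereTanProj_apply'`). [folklore] -/
@[simp] private theorem sphereTanProj_apply' (p X : E3) : sphereTanProj p X = X - ⟪p, X⟫ • p := by
  simp [sphereTanProj, ContinuousLinearMap.smulRight_apply]

/-- The inner product of `E3` as an `ℝ`-BILINEAR continuous map (the tree's ascription
`(innerSL ℝ : E3 →L[ℝ] E3 →L[ℝ] ℝ)`, given a name so that `simp` sees its applications).
[folklore] -/
def innerBil : E3 →L[ℝ] E3 →L[ℝ] ℝ := innerSL ℝ

/-- Helper (`innerBil_apply`). [cite: Ellithy2026, Def. 3.6, p. 21] -/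
@[simp] theorem innerBil_apply (X Y : E3) : innerBil X Y = ⟪X, Y⟫ := rfl

/-- Helper (`innerSL_eq_innerBil`). [folklore] -/
private theorem innerSL_eq_innerBil : (innerSL ℝ : E3 →L[ℝ] E3 →L[ℝ] ℝ) = innerBil := rfl

/-- The round metric of the unit sphere at a unit vector `q`, as the polynomial bilinear form
`⟪X, Y⟫ - ⟪q, X⟫ ⟪q, Y⟫` on `E3` (equal to `⟪Π_q X, Π_q Y⟫` for `‖q‖ = 1`).
[cite: Ellithy2026, Def. 3.6, p. 21] -/
def roundAt (q : E3) : E3 →L[ℝ] E3 →L[ℝ] ℝ :=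
  innerBil - (innerSL ℝ q).smulRight (innerSL ℝ q)

/-- Helper (`roundAt_apply`). [cite: Ellithy2026, Def. 3.6, p. 21] -/
@[simp] theorem roundAt_apply (q X Y : E3) : roundAt q X Y = ⟪X, Y⟫ - ⟪q, X⟫ * ⟪q, Y⟫ := by
  simp [roundAt, ContinuousLinearMap.smulRight_apply]

/-- **The flat tuple** `𝒮₀ = (N, λ, β_r, β^T, b, γ) = (1, 1, 0, 0, 0, r² γ_{S²})` (Minkowski space in
the standard foliation `t = const`, `r = |y|`). [cite: Ellithy2026, Def. 3.6, p. 21] -/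
def flat : ADMTailTuple where
  N := fun _ _ _ ↦ 1
  lam := fun _ _ _ ↦ 1
  βr := fun _ _ _ ↦ 0
  βT := fun _ _ _ ↦ 0
  b := fun _ _ _ ↦ 0
  γ := fun _ r q ↦ (r ^ 2) • roundAt (q : E3)

/-- The flat (Minkowski) tuple: `N`. [cite: Ellithy2026, Def. 3.6, p. 21] -/
@[simp] theorem flat_N (t r : ℝ) (p : sphere (0 : E3) 1) : flat.N t r p = 1 := rfl
/-- The flat (Minkowski) tuple: `lam`. [cite: Ellithy2026, Def. 3.6, p. 21] -/
@[simp] theorem flat_lam (t r : ℝ) (p : sphere (0 : E3) 1) : flat.lam t r p = 1 := rfl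
/-- The flat (Minkowski) tuple: `βr`. [cite: Ellithy2026, Def. 3.6, p. 21] -/
@[simp] theorem flat_βr (t r : ℝ) (p : sphere (0 : E3) 1) : flat.βr t r p = 0 := rfl
/-- The flat (Minkowski) tuple: `βT`. [cite: Ellithy2026, Def. 3.6, p. 21] -/
@[simp] theorem flat_βT (t r : ℝ) (p : sphere (0 : E3) 1) : flat.βT t r p = 0 := rfl
/-- The flat (Minkowski) tuple: `b`. [cite: Ellithy2026, Def. 3.6, p. 21] -/
@[simp] theorem flat_b (t r : ℝ) (p : sphere (0 : E3) 1) : flat.b t r p = 0 := rfl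
/-- The flat (Minkowski) tuple: `γ`. [cite: Ellithy2026, Def. 3.6, p. 21] -/
@[simp] theorem flat_γ (t r : ℝ) (p : sphere (0 : E3) 1) : flat.γ t r p = (r ^ 2) • roundAt (p : E3) := rfl

/-- `γ_{S²}(Π_q ·, Π_q ·) = γ_{S²}` at a unit vector. [folklore] -/
private theorem roundAt_bilinearComp (p : sphere (0 : E3) 1) :
    (roundAt (p : E3)).bilinearComp (sphereTanProj (p : E3)) (sphereTanProj (p : E3)) = roundAt (p : E3) := by
  ext X Y
  simp [inner_sub_right, inner_smul_right, real_inner_comm]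
  ring

/-- The tree's rendering `⟪Π_p ·, Π_p ·⟫` of the round metric is `roundAt p`. [folklore] -/
private theorem innerSL_bilinearComp (p : sphere (0 : E3) 1) :
    (innerSL ℝ : E3 →L[ℝ] E3 →L[ℝ] ℝ).bilinearComp (sphereTanProj (p : E3)) (sphereTanProj (p : E3)) =
      roundAt (p : E3) := by
  refine ContinuousLinearMap.ext fun X ↦ ContinuousLinearMap.ext fun Y ↦ ?_
  change ⟪sphereTanProj (p : E3) X, sphereTanProj (p : E3) Y⟫ = roundAt (p : E3) X Y
  simp [inner_sub_left, inner_sub_right, inner_smul_left, inner_smul_right,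
    real_inner_comm]

/-- Helper (`smul_bilinearComp`). [folklore] -/
private theorem smul_bilinearComp (c : ℝ) (f : E3 →L[ℝ] E3 →L[ℝ] ℝ) (g h : E3 →L[ℝ] E3) :
    (c • f).bilinearComp g h = c • f.bilinearComp g h := by
  ext X Y; simp

/-- The flat (Minkowski) tuple: `gammaTan`. [cite: Ellithy2026, Def. 3.6, p. 21] -/
@[simp] theorem flat_gammaTan (t r : ℝ) (p : sphere (0 : E3) 1) :
    flat.gammaTan t r p = (r ^ 2) • roundAt (p : E3) := by
  rw [ADMTailTuple.gammaTan, flat_γ, smul_bilinearComp, roundAt_bilinearComp]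

/-- The flat (Minkowski) tuple: `gammaDev`. [cite: Ellithy2026, Def. 3.6, p. 21] -/
theorem flat_gammaDev {r : ℝ} (hr : r ≠ 0) (t : ℝ) (p : sphere (0 : E3) 1) :
    flat.gammaDev t r p = 0 := by
  simp only [ADMTailTuple.gammaDev]
  rw [flat_gammaTan, smul_smul, inv_mul_cancel₀ (pow_ne_zero 2 hr), one_smul, innerSL_bilinearComp,
    sub_self]

/-- The flat (Minkowski) tuple: `lapseDev`. [cite: Ellithy2026, Def. 3.6, p. 21] -/
@[simp] theorem flat_lapseDev : flat.lapseDev = fun _ _ _ ↦ 0 := by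
  funext t r p; simp [ADMTailTuple.lapseDev]

/-- The flat (Minkowski) tuple: `lamDev`. [cite: Ellithy2026, Def. 3.6, p. 21] -/
@[simp] theorem flat_lamDev : flat.lamDev = fun _ _ _ ↦ 0 := by
  funext t r p; simp [ADMTailTuple.lamDev]

/-- The flat (Minkowski) tuple: `shift`. [cite: Ellithy2026, Def. 3.6, p. 21] -/
@[simp] theorem flat_shift : flat.shift = fun _ _ _ ↦ 0 := by
  funext t r p; simp [ADMTailTuple.shift]

/-- The flat (Minkowski) tuple: `b_fun`. [cite: Ellithy2026, Def. 3.6, p. 21] -/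
theorem flat_b_fun : flat.b = fun _ _ _ ↦ 0 := rfl

/-- The flat (Minkowski) tuple: `gammaHat_apply`. [cite: Ellithy2026, Def. 3.6, p. 21] -/
@[simp] theorem flat_gammaHat_apply (t r : ℝ) (p : sphere (0 : E3) 1) (X Y : E3) :
    flat.gammaHat t r p X Y = r ^ 2 * (⟪X, Y⟫ - ⟪(p : E3), X⟫ * ⟪(p : E3), Y⟫) + ⟪(p : E3), X⟫ * ⟪(p : E3), Y⟫ := by
  simp [ADMTailTuple.gammaHat]

/-! ## §2 Tail norms of functions vanishing on an open tail -/

section Zero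

variable {W : Type*} [NormedAddCommGroup W] [NormedSpace ℝ W]

/-- Helper (`sphereCovDeriv_zero_fun`). [folklore] -/
@[simp] private theorem sphereCovDeriv_zero_fun (k : ℕ) (p : sphere (0 : E3) 1) :
    sphereCovDeriv k (fun _ : sphere (0 : E3) 1 ↦ (0 : W)) p = 0 := by
  induction k generalizing p with
  | zero => ext m; simp
  | succ k ih =>
    ext m
    rw [sphereCovDeriv_succ_apply]
    simp [ih]

/-- Helper (`sphereDiffAt_zero_fun`). [folklore] -/
private theorem sphereDiffAt_zero_fun (k : ℕ) (p : sphere (0 : E3) 1) :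
    SphereDiffAt k (fun _ : sphere (0 : E3) 1 ↦ (0 : W)) p := by
  intro j hj
  simp only [sphereCovDeriv_zero_fun]
  exact differentiableAt_const _

/-- Helper (`iteratedDeriv_zero_fun`). [folklore] -/
private theorem iteratedDeriv_zero_fun (n : ℕ) : iteratedDeriv n (fun _ : ℝ ↦ (0 : W)) = fun _ ↦ 0 := by
  funext x; rw [iteratedDeriv_const]; split_ifs <;> rfl

/-- Helper (`eventuallyEq_iteratedDeriv`). [folklore] -/
private theorem eventuallyEq_iteratedDeriv {f g : ℝ → W} {x : ℝ} (h : f =ᶠ[𝓝 x] g) (n : ℕ) :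
    iteratedDeriv n f =ᶠ[𝓝 x] iteratedDeriv n g :=
  (h.iteratedFDeriv ℝ n).mono fun y hy ↦ by rw [iteratedDeriv_eq_iteratedFDeriv, iteratedDeriv_eq_iteratedFDeriv, hy]

variable {J : Set ℝ}

omit [NormedSpace ℝ W] in
/-- A function of `(r, p)` that vanishes identically for `r` in the open set `J` is eventually
zero (in `r`, at fixed `p`) near every point of `J`. [folklore] -/
private theorem eventuallyEq_zero_of_vanish (hJ : IsOpen J) {v : ℝ → sphere (0 : E3) 1 → W}
    (hv : ∀ r ∈ J, v r = fun _ ↦ 0) {r : ℝ} (hr : r ∈ J) (p : sphere (0 : E3) 1) :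
    (fun ρ ↦ v ρ p) =ᶠ[𝓝 r] fun _ ↦ 0 :=
  Filter.eventuallyEq_of_mem (hJ.mem_nhds hr) fun ρ hρ ↦ by simp [hv ρ hρ]

/-- Helper (`eventuallyEq_zero_cov_of_vanish`). [folklore] -/
private theorem eventuallyEq_zero_cov_of_vanish (hJ : IsOpen J) {v : ℝ → sphere (0 : E3) 1 → W}
    (hv : ∀ r ∈ J, v r = fun _ ↦ 0) {r : ℝ} (hr : r ∈ J) (p : sphere (0 : E3) 1) (j : ℕ) :
    (fun ρ ↦ sphereCovDeriv j (v ρ) p) =ᶠ[𝓝 r] fun _ ↦ 0 :=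
  Filter.eventuallyEq_of_mem (hJ.mem_nhds hr) fun ρ hρ ↦ by simp [hv ρ hρ]

omit [NormedSpace ℝ W] in
/-- Helper (`tailSupNorm_of_vanish`). [folklore] -/
private theorem tailSupNorm_of_vanish {v : ℝ → sphere (0 : E3) 1 → W} (hv : ∀ r ∈ J, v r = fun _ ↦ 0) :
    tailSupNorm J v = 0 := by
  simp only [tailSupNorm, ENNReal.iSup_eq_zero]
  intro r hr p; simp [hv r hr]

omit [NormedSpace ℝ W] in
/-- Helper (`tailHolderSeminorm_of_vanish`). [folklore] -/
private theorem tailHolderSeminorm_of_vanish (α : ℝ) {v : ℝ → sphere (0 : E3) 1 → W}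
    (hv : ∀ r ∈ J, v r = fun _ ↦ 0) : tailHolderSeminorm α J v = 0 := by
  simp only [tailHolderSeminorm, ENNReal.iSup_eq_zero]
  intro z z' hz hz' _; simp [hv z.1 hz, hv z'.1 hz']

omit [NormedSpace ℝ W] in
/-- Helper (`czNorm_of_vanish`). [folklore] -/
private theorem czNorm_of_vanish (α : ℝ) {v : ℝ → sphere (0 : E3) 1 → W} (hv : ∀ r ∈ J, v r = fun _ ↦ 0) :
    czNorm α J v = 0 := by
  rw [czNorm, tailSupNorm_of_vanish hv, tailHolderSeminorm_of_vanish α hv, add_zero]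

/-- Helper (`rpowWeight_vanish`). [folklore] -/
private theorem rpowWeight_vanish (σ : ℝ) {v : ℝ → sphere (0 : E3) 1 → W} (hv : ∀ r ∈ J, v r = fun _ ↦ 0) :
    ∀ r ∈ J, rpowWeight σ v r = fun _ ↦ 0 := by
  intro r hr; funext p; simp [rpowWeight, hv r hr]

/-- Helper (`angPart_vanish`). [folklore] -/
private theorem angPart_vanish (k : ℕ) {v : ℝ → sphere (0 : E3) 1 → W} (hv : ∀ r ∈ J, v r = fun _ ↦ 0) :
    ∀ r ∈ J, angPart k v r = fun _ ↦ 0 := by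
  intro r hr; funext p; simp [angPart, hv r hr]

/-- Helper (`sDeriv_vanish`). [folklore] -/
private theorem sDeriv_vanish (hJ : IsOpen J) {v : ℝ → sphere (0 : E3) 1 → W} (hv : ∀ r ∈ J, v r = fun _ ↦ 0) :
    ∀ r ∈ J, sDeriv v r = fun _ ↦ 0 := by
  intro r hr; funext p
  simp only [sDeriv]
  rw [(eventuallyEq_zero_of_vanish hJ hv hr p).deriv_eq, deriv_const, smul_zero, neg_zero]

/-- Helper (`radAngPart_vanish`). [folklore] -/
private theorem radAngPart_vanish (hJ : IsOpen J) (ℓ j : ℕ) {v : ℝ → sphere (0 : E3) 1 → W}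
    (hv : ∀ r ∈ J, v r = fun _ ↦ 0) : ∀ r ∈ J, radAngPart ℓ j v r = fun _ ↦ 0 := by
  intro r hr; funext p
  simp only [radAngPart]
  rw [(eventuallyEq_iteratedDeriv (eventuallyEq_zero_cov_of_vanish hJ hv hr p j) ℓ).eq_of_nhds,
    iteratedDeriv_zero_fun]

/-- Helper (`ctRegularOn_of_vanish`). [folklore] -/
private theorem ctRegularOn_of_vanish (hJ : IsOpen J) {v : ℝ → sphere (0 : E3) 1 → W}
    (hv : ∀ r ∈ J, v r = fun _ ↦ 0) : CtRegularOn J v := by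
  refine ⟨fun r hr p ↦ ?_, fun r hr p ↦ ?_⟩
  · rw [hv r hr]; exact sphereDiffAt_zero_fun 2 p
  · exact (eventuallyEq_zero_of_vanish hJ hv hr p).differentiableAt_iff.mpr (differentiableAt_const _)

/-- Helper (`ctNorm_of_vanish`). [folklore] -/
private theorem ctNorm_of_vanish (hJ : IsOpen J) (α : ℝ) {v : ℝ → sphere (0 : E3) 1 → W}
    (hv : ∀ r ∈ J, v r = fun _ ↦ 0) : ctNorm α J v = 0 := by
  simp only [ctNorm, ctRegularOn_of_vanish hJ hv, if_true, tailSupNorm_of_vanish hv,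
    tailSupNorm_of_vanish (angPart_vanish 1 hv), tailSupNorm_of_vanish (angPart_vanish 2 hv),
    tailSupNorm_of_vanish (sDeriv_vanish hJ hv), tailHolderSeminorm_of_vanish α (angPart_vanish 2 hv),
    tailHolderSeminorm_of_vanish α (sDeriv_vanish hJ hv), add_zero]

/-- Helper (`ctWeightedNorm_of_vanish`). [folklore] -/
private theorem ctWeightedNorm_of_vanish (hJ : IsOpen J) (α σ : ℝ) {v : ℝ → sphere (0 : E3) 1 → W}
    (hv : ∀ r ∈ J, v r = fun _ ↦ 0) : ctWeightedNorm α σ J v = 0 :=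
  ctNorm_of_vanish hJ α (rpowWeight_vanish σ hv)

/-- Helper (`ctSharpRegularOn_of_vanish`). [folklore] -/
private theorem ctSharpRegularOn_of_vanish (hJ : IsOpen J) {v : ℝ → sphere (0 : E3) 1 → W}
    (hv : ∀ r ∈ J, v r = fun _ ↦ 0) : CtSharpRegularOn J v := by
  refine ⟨fun r hr p ↦ ?_, fun ℓ j _ _ _ r hr p m _ ↦ ?_⟩
  · rw [hv r hr]; exact sphereDiffAt_zero_fun 4 p
  · have h := eventuallyEq_iteratedDeriv (eventuallyEq_zero_cov_of_vanish hJ hv hr p j) m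
    rw [iteratedDeriv_zero_fun] at h
    exact h.differentiableAt_iff.mpr (differentiableAt_const _)

/-- Helper (`ctSharpWeightedNorm_of_vanish`). [folklore] -/
private theorem ctSharpWeightedNorm_of_vanish (hJ : IsOpen J) (α σ : ℝ) {v : ℝ → sphere (0 : E3) 1 → W}
    (hv : ∀ r ∈ J, v r = fun _ ↦ 0) : ctSharpWeightedNorm α σ J v = 0 := by
  simp only [ctSharpWeightedNorm, ctSharpRegularOn_of_vanish hJ hv, if_true,
    ctWeightedNorm_of_vanish hJ α σ hv]
  rw [Finset.sum_eq_zero, Finset.sum_eq_zero]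
  · simp
  · intro ℓ _
    exact Finset.sum_eq_zero fun j _ ↦ czNorm_of_vanish α (rpowWeight_vanish _ (radAngPart_vanish hJ ℓ j hv))
  · intro j _
    exact tailSupNorm_of_vanish (rpowWeight_vanish σ (angPart_vanish j hv))

/-- Time-dependent version: a field vanishing on the slab `r > r₁` (all `t`, `p`) has zero
`sup_{t} ‖∂_t^j ·‖_{C^{2+α,1+α/2}_{-σ}(M_{r₁,∞})}`. [folklore] -/
private theorem supTailNorm_of_vanish (α σ : ℝ) (j : ℕ) (Tlo r₁ : ℝ) {f : ℝ → ℝ → sphere (0 : E3) 1 → W}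
    (hf : ∀ t r, r₁ < r → f t r = fun _ ↦ 0) : ADMTailTuple.supTailNorm α σ j Tlo r₁ f = 0 := by
  have hconst : ∀ r, r₁ < r → ∀ p, (fun s ↦ f s r p) = fun _ ↦ 0 := by
    intro r hr p; funext s; simp [hf s r hr]
  have hT : ADMTailTuple.TDiffOn j Tlo r₁ f := by
    intro t _ r hr p m _
    rw [hconst r hr p, iteratedDeriv_zero_fun]; exact differentiableAt_const _
  have hD : ∀ t, ∀ r ∈ Ioi r₁, ADMTailTuple.tDeriv j f t r = fun _ ↦ 0 := by
    intro t r hr; funext p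
    simp only [ADMTailTuple.tDeriv]; rw [hconst r hr p, iteratedDeriv_zero_fun]
  simp only [ADMTailTuple.supTailNorm, hT, if_true, ENNReal.iSup_eq_zero]
  intro t _; exact ctWeightedNorm_of_vanish isOpen_Ioi α σ (hD t)

/-- Helper (`supSharpTailNorm_of_vanish`). [folklore] -/
private theorem supSharpTailNorm_of_vanish (α σ : ℝ) (k : ℕ) (Tlo r₁ : ℝ) {f : ℝ → ℝ → sphere (0 : E3) 1 → W}
    (hf : ∀ t r, r₁ < r → f t r = fun _ ↦ 0) : ADMTailTuple.supSharpTailNorm α σ k Tlo r₁ f = 0 := by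
  have hconst : ∀ r, r₁ < r → ∀ p, (fun s ↦ f s r p) = fun _ ↦ 0 := by
    intro r hr p; funext s; simp [hf s r hr]
  have hT : ADMTailTuple.TDiffOn k Tlo r₁ f := by
    intro t _ r hr p m _
    rw [hconst r hr p, iteratedDeriv_zero_fun]; exact differentiableAt_const _
  have hD : ∀ t, ∀ r ∈ Ioi r₁, ADMTailTuple.tDeriv k f t r = fun _ ↦ 0 := by
    intro t r hr; funext p
    simp only [ADMTailTuple.tDeriv]; rw [hconst r hr p, iteratedDeriv_zero_fun]
  simp only [ADMTailTuple.supSharpTailNorm, hT, if_true, ENNReal.iSup_eq_zero]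
  intro t _; exact ctSharpWeightedNorm_of_vanish isOpen_Ioi α σ (hD t)

/-- Helper (`supTailNorm_zero_fun`). [folklore] -/
@[simp] private theorem supTailNorm_zero_fun (α σ : ℝ) (j : ℕ) (Tlo r₁ : ℝ) :
    ADMTailTuple.supTailNorm α σ j Tlo r₁ (fun _ _ _ ↦ (0 : W)) = 0 :=
  supTailNorm_of_vanish α σ j Tlo r₁ fun _ _ _ ↦ rfl

/-- Helper (`supSharpTailNorm_zero_fun`). [folklore] -/
@[simp] private theorem supSharpTailNorm_zero_fun (α σ : ℝ) (k : ℕ) (Tlo r₁ : ℝ) :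
    ADMTailTuple.supSharpTailNorm α σ k Tlo r₁ (fun _ _ _ ↦ (0 : W)) = 0 :=
  supSharpTailNorm_of_vanish α σ k Tlo r₁ fun _ _ _ ↦ rfl

end Zero

/-! ## §3 The norm half: `𝒩_τ(r₁) = 0`, `𝒩♯_τ(r₁) = 0` for the flat tuple (`r₁ > 0`) -/

/-- The flat (Minkowski) tuple: `gammaDev_vanish`. [cite: Ellithy2026, Def. 3.6, p. 21] -/
theorem flat_gammaDev_vanish {r₁ : ℝ} (hr₁ : 0 ≤ r₁) :
    ∀ t r, r₁ < r → flat.gammaDev t r = fun _ ↦ 0 := by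
  intro t r hr; funext p; exact flat_gammaDev (ne_of_gt (lt_of_le_of_lt hr₁ hr)) t p

/-- The flat (Minkowski) tuple: `tailNormN`. [cite: Ellithy2026, Def. 3.6, p. 21] -/
theorem flat_tailNormN {r₁ : ℝ} (hr₁ : 0 ≤ r₁) (α τ Tlo : ℝ) : flat.tailNormN α τ Tlo r₁ = 0 := by
  simp only [ADMTailTuple.tailNormN, flat_lapseDev, flat_lamDev, flat_shift, flat_b_fun]
  refine Finset.sum_eq_zero fun j _ ↦ ?_
  rw [supTailNorm_of_vanish _ _ _ _ _ (flat_gammaDev_vanish hr₁)]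
  simp

/-- The flat (Minkowski) tuple: `sharpTailNormN`. [cite: Ellithy2026, Def. 3.8, p. 22] -/
theorem flat_sharpTailNormN {r₁ : ℝ} (hr₁ : 0 ≤ r₁) (α τ Tlo : ℝ) : flat.sharpTailNormN α τ Tlo r₁ = 0 := by
  simp only [ADMTailTuple.sharpTailNormN, flat_lapseDev, flat_lamDev, flat_shift, flat_b_fun]
  refine Finset.sum_eq_zero fun k _ ↦ ?_
  rw [supSharpTailNorm_of_vanish _ _ _ _ _ (flat_gammaDev_vanish hr₁)]
  simp

/-! ## §4 Well-formedness -/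

/-- The flat (Minkowski) tuple: `isWellFormedOn`. [cite: Ellithy2026, Def. 3.6, p. 21] -/
theorem flat_isWellFormedOn {r₀ : ℝ} (hr₀ : 0 ≤ r₀) (Tlo : ℝ) : flat.IsWellFormedOn Tlo r₀ := by
  intro t r p _ hr
  refine ⟨by simp, by simp, ?_, ?_, ?_⟩
  · rw [flat_γ, smul_bilinearComp, roundAt_bilinearComp]
  · intro X Y; simp [real_inner_comm, mul_comm]
  · intro X hX hX0
    have hr' : 0 < r := lt_of_le_of_lt hr₀ hr
    have hXX : 0 < ⟪X, X⟫ := real_inner_self_pos.mpr hX0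
    simp [hX]
    positivity


/-! ## §5 Inverting `γ̂` for the flat tuple: `r H_{t,r} ≡ 2` -/

/-- Riesz: an angular/ambient covector as a vector of `E3`. [folklore] -/
def toVec : (E3 →L[ℝ] ℝ) →L[ℝ] E3 :=
  ((InnerProductSpace.toDual ℝ E3).symm.toContinuousLinearEquiv : (E3 →L[ℝ] ℝ) →L[ℝ] E3)

/-- Helper (`inner_toVec_left`). [folklore] -/
private theorem inner_toVec_left (ω : E3 →L[ℝ] ℝ) (Y : E3) : ⟪toVec ω, Y⟫ = ω Y :=
  InnerProductSpace.toDual_symm_apply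

/-- Helper (`inner_toVec_right`). [folklore] -/
private theorem inner_toVec_right (ω : E3 →L[ℝ] ℝ) (Y : E3) : ⟪Y, toVec ω⟫ = ω Y := by
  rw [real_inner_comm, inner_toVec_left]

/-- The explicit inverse `ψ_{r,p}` of `γ̂` for the flat tuple at radius `r ≠ 0`:
`ψ ω = r⁻² ω^♯ + (1 - r⁻²) ω(p) p`. [cite: Ellithy2026, Def. 3.6, p. 21] -/
def psi (r : ℝ) (p : E3) : (E3 →L[ℝ] ℝ) →L[ℝ] E3 :=
  (r ^ 2)⁻¹ • toVec + (1 - (r ^ 2)⁻¹) • ((innerSL ℝ p).comp toVec).smulRight p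

/-- Helper (`psi_apply`). [folklore] -/
private theorem psi_apply (r : ℝ) (p : E3) (ω : E3 →L[ℝ] ℝ) :
    psi r p ω = (r ^ 2)⁻¹ • toVec ω + ((1 - (r ^ 2)⁻¹) * ω p) • p := by
  simp [psi, ContinuousLinearMap.smulRight_apply, inner_toVec_right, smul_smul]

/-- Helper (`inner_psi`). [folklore] -/
private theorem inner_psi (r : ℝ) (p : E3) (ω : E3 →L[ℝ] ℝ) (Y : E3) :
    ⟪psi r p ω, Y⟫ = (r ^ 2)⁻¹ * ω Y + (1 - (r ^ 2)⁻¹) * ω p * ⟪p, Y⟫ := by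
  rw [psi_apply, inner_add_left, real_inner_smul_left, real_inner_smul_left, inner_toVec_left]

/-- Helper (`inner_psi_self`). [folklore] -/
private theorem inner_psi_self (r : ℝ) (p : sphere (0 : E3) 1) (ω : E3 →L[ℝ] ℝ) :
    ⟪(p : E3), psi r p ω⟫ = ω p := by
  rw [real_inner_comm, inner_psi, inner_self_sphere]; ring

/-- Helper (`psi_gammaHat`). [folklore] -/
private theorem psi_gammaHat {r : ℝ} (hr : r ≠ 0) (t : ℝ) (p : sphere (0 : E3) 1) (X : E3) :
    psi r p (flat.gammaHat t r p X) = X := by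
  refine ext_inner_right ℝ fun Y ↦ ?_
  rw [inner_psi, flat_gammaHat_apply, flat_gammaHat_apply, inner_self_sphere, real_inner_comm (p : E3) X]
  field_simp
  ring

/-- Helper (`gammaHat_psi`). [folklore] -/
private theorem gammaHat_psi {r : ℝ} (hr : r ≠ 0) (t : ℝ) (p : sphere (0 : E3) 1) (ω : E3 →L[ℝ] ℝ) :
    flat.gammaHat t r p (psi r p ω) = ω := by
  ext Y
  rw [flat_gammaHat_apply, inner_psi, inner_psi_self]
  field_simp
  ring

/-- `γ̂` of the flat tuple as a continuous linear equivalence (radius `r ≠ 0`).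
[cite: Ellithy2026, Def. 3.6, p. 21] -/
def gammaHatEquiv {r : ℝ} (hr : r ≠ 0) (t : ℝ) (p : sphere (0 : E3) 1) : E3 ≃L[ℝ] (E3 →L[ℝ] ℝ) :=
  ContinuousLinearEquiv.equivOfInverse (flat.gammaHat t r p) (psi r p) (psi_gammaHat hr t p)
    (gammaHat_psi hr t p)

/-- The flat (Minkowski) tuple: `gammaHat_inverse`. [cite: Ellithy2026, Def. 3.6, p. 21] -/
theorem flat_gammaHat_inverse {r : ℝ} (hr : r ≠ 0) (t : ℝ) (p : sphere (0 : E3) 1) :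
    (flat.gammaHat t r p).inverse = psi r p := by
  have h : flat.gammaHat t r p = (gammaHatEquiv hr t p : E3 →L[ℝ] (E3 →L[ℝ] ℝ)) := rfl
  rw [h, ContinuousLinearMap.inverse_equiv, gammaHatEquiv, ContinuousLinearEquiv.symm_equivOfInverse]
  rfl

/-- The flat (Minkowski) tuple: `bSharp`. [cite: Ellithy2026, Def. 3.6, p. 21] -/
@[simp] theorem flat_bSharp (t r : ℝ) (q : sphere (0 : E3) 1) : flat.bSharp t r q = 0 := by
  simp [ADMTailTuple.bSharp, ADMTailTuple.gammaSharp]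

/-- The flat (Minkowski) tuple: `gammaNormSq_zero`. [cite: Ellithy2026, Def. 3.6, p. 21] -/
@[simp] theorem flat_gammaNormSq_zero (t r : ℝ) (p : sphere (0 : E3) 1) : flat.gammaNormSq t r p 0 = 0 := by
  simp [ADMTailTuple.gammaNormSq]

/-- The flat (Minkowski) tuple: `gammaNormSqBilin_zero`. [cite: Ellithy2026, Def. 3.6, p. 21] -/
@[simp] theorem flat_gammaNormSqBilin_zero (t r : ℝ) (p : sphere (0 : E3) 1) :
    flat.gammaNormSqBilin t r p 0 = 0 := by
  simp [ADMTailTuple.gammaNormSqBilin]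

/-- The flat (Minkowski) tuple: `dGammaDr`. [cite: Ellithy2026, Def. 3.6, p. 21] -/
theorem flat_dGammaDr (t r : ℝ) (p : sphere (0 : E3) 1) : flat.dGammaDr t r p = (2 * r) • roundAt (p : E3) := by
  simp only [ADMTailTuple.dGammaDr, flat_γ]
  rw [deriv_smul_const (by fun_prop)]
  congr 1
  simp

/-- Helper (`sphereCovDeriv_zero_eq`). [folklore] -/
private theorem sphereCovDeriv_zero_eq {W : Type*} [NormedAddCommGroup W] [NormedSpace ℝ W]
    (v : sphere (0 : E3) 1 → W) (q : sphere (0 : E3) 1) :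
    sphereCovDeriv 0 v q = ContinuousMultilinearMap.uncurry0 ℝ E3 (v q) := rfl

/-- The flat (Minkowski) tuple: `bSharp_fun`. [cite: Ellithy2026, Def. 3.6, p. 21] -/
theorem flat_bSharp_fun (t r : ℝ) : (fun q : sphere (0 : E3) 1 ↦ flat.bSharp t r q) = fun _ ↦ 0 :=
  funext (flat_bSharp t r)

/-- The flat (Minkowski) tuple: `lieBSharpGamma`. [cite: Ellithy2026, Def. 3.6, p. 21] -/
theorem flat_lieBSharpGamma (t r : ℝ) (p : sphere (0 : E3) 1) : flat.lieBSharpGamma t r p = 0 := by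
  simp only [ADMTailTuple.lieBSharpGamma, flat_bSharp, sphereCovDeriv_zero_fun, map_zero,
    ContinuousLinearMap.comp_zero, ContinuousLinearMap.bilinearComp_zero,
    ContinuousLinearMap.bilinearComp_zero_left, ContinuousLinearMap.bilinearComp_zero_right, add_zero]

/-- Helper (`psi_comp_round`). [folklore] -/
private theorem psi_comp_round {r : ℝ} (hr : r ≠ 0) (p : sphere (0 : E3) 1) :
    (psi r p).comp (((2 * r) • roundAt (p : E3)).bilinearComp (sphereTanProj (p : E3)) (sphereTanProj (p : E3))) =
      (2 / r) • sphereTanProj (p : E3) := by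
  rw [smul_bilinearComp, roundAt_bilinearComp]
  refine ContinuousLinearMap.ext fun X ↦ ext_inner_right ℝ fun Y ↦ ?_
  rw [ContinuousLinearMap.comp_apply, inner_psi]
  simp only [smul_apply, roundAt_apply, smul_eq_mul, inner_self_sphere,
    sphereTanProj_apply', inner_sub_left, real_inner_smul_left, real_inner_comm (p : E3) X]
  field_simp
  ring

/-- Helper (`trace_sphereTanProj`). [folklore] -/
private theorem trace_sphereTanProj (p : sphere (0 : E3) 1) :
    LinearMap.trace ℝ E3 (sphereTanProj (p : E3) : E3 →ₗ[ℝ] E3) = 2 := by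
  have hPi : (sphereTanProj (p : E3) : E3 →ₗ[ℝ] E3) =
      LinearMap.id - ((innerSL ℝ (p : E3) : E3 →L[ℝ] ℝ) : E3 →ₗ[ℝ] ℝ).smulRight (p : E3) := by
    ext X; simp
  rw [hPi, map_sub, LinearMap.trace_id, LinearMap.trace_smulRight, finrank_euclideanSpace_fin]
  simp
  norm_num

/-- The flat (Minkowski) tuple: `gammaTrace`. [cite: Ellithy2026, Def. 3.6, p. 21] -/
theorem flat_gammaTrace {r : ℝ} (hr : r ≠ 0) (t : ℝ) (p : sphere (0 : E3) 1) :
    flat.gammaTrace t r p (flat.dGammaDr t r p - flat.lieBSharpGamma t r p) = 4 / r := by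
  rw [flat_dGammaDr, flat_lieBSharpGamma, sub_zero, ADMTailTuple.gammaTrace, flat_gammaHat_inverse hr,
    psi_comp_round hr, ContinuousLinearMap.toLinearMap_smul, map_smul, trace_sphereTanProj]
  simp; ring

/-- The flat (Minkowski) tuple: `r_mul_meanCurv`. [cite: Ellithy2026, Def. 3.6, p. 21] -/
theorem flat_r_mul_meanCurv {r : ℝ} (hr : r ≠ 0) (t : ℝ) (p : sphere (0 : E3) 1) :
    r * flat.meanCurv t r p = 2 := by
  rw [ADMTailTuple.meanCurv, flat_gammaTrace hr, flat_lam]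
  field_simp
  ring

/-- The flat (Minkowski) tuple: `isTailNondegenerate`. [cite: Ellithy2026, Def. 3.6, p. 21] -/
theorem flat_isTailNondegenerate {r₁ : ℝ} (hr₁ : 0 ≤ r₁) (Tlo : ℝ) : flat.IsTailNondegenerate Tlo r₁ := by
  refine ⟨1, 1, 1 / 2, one_pos, one_pos, by norm_num, fun t r p _ hr ↦ ?_⟩
  have hr0 : r ≠ 0 := ne_of_gt (lt_of_le_of_lt hr₁ hr)
  have h2 := flat_r_mul_meanCurv hr0 t p
  simp only [flat_lam, flat_N, flat_βT, flat_gammaNormSq_zero, h2]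
  norm_num

/-! ## §6 The forcing vanishes: `K_t ≡ 0`, `Ξ ≡ 0`, and the regularity guards hold -/

/-- The flat (Minkowski) tuple: `βCart`. [cite: Ellithy2026, Def. 3.6, p. 21] -/
theorem flat_βCart (t : ℝ) (y : E3) : flat.βCart t y = 0 := by
  simp [ADMTailTuple.βCart]

/-- The flat (Minkowski) tuple: `βCart_fun`. [cite: Ellithy2026, Def. 3.6, p. 21] -/
theorem flat_βCart_fun (t : ℝ) : (fun y ↦ flat.βCart t y) = fun _ ↦ 0 := funext (flat_βCart t)

/-- Helper (`coe_raySphere'`). [folklore] -/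
private theorem coe_raySphere' {y : E3} (hy : y ≠ 0) : (raySphere y : E3) = ‖y‖⁻¹ • y := by
  simp [raySphere, hy]

/-- In the Cartesian chart the flat slice metric is the Euclidean one (away from the origin).
[cite: Ellithy2026, Def. 3.6, p. 21] -/
theorem flat_gCart_eq (t : ℝ) {y : E3} (hy : y ≠ 0) : flat.gCart t y = innerBil := by
  have hn : ‖y‖ ≠ 0 := norm_ne_zero_iff.mpr hy
  refine ContinuousLinearMap.ext fun X ↦ ContinuousLinearMap.ext fun Y ↦ ?_
  simp [ADMTailTuple.gCart, ADMTailTuple.angVel, inner_sub_right, real_inner_smul_right, real_inner_comm]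
  field_simp
  ring

/-- The flat (Minkowski) tuple: `gCart_const`. [cite: Ellithy2026, Def. 3.6, p. 21] -/
theorem flat_gCart_const (s t : ℝ) (y : E3) : flat.gCart s y = flat.gCart t y := rfl

/-- The flat (Minkowski) tuple: `sliceK`. [cite: Ellithy2026, Def. 3.6, p. 21] -/
theorem flat_sliceK (t : ℝ) (y : E3) : flat.sliceK t y = 0 := by
  have h1 : deriv (fun s ↦ flat.gCart s y) t = 0 := by
    rw [show (fun s ↦ flat.gCart s y) = fun _ ↦ flat.gCart t y from rfl, deriv_const]
  have h2 : fderiv ℝ (fun z ↦ flat.βCart t z) y = 0 := by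
    rw [flat_βCart_fun]; simp
  simp only [ADMTailTuple.sliceK, h1, h2]
  simp only [flat_βCart, map_zero, ContinuousLinearMap.zero_comp, sub_zero, ContinuousLinearMap.flip_zero,
    smul_zero]

/-- The flat (Minkowski) tuple: `traceSK`. [cite: Ellithy2026, Def. 3.6, p. 21] -/
theorem flat_traceSK (t : ℝ) (y : E3) : flat.traceSK t y = 0 := by
  simp [ADMTailTuple.traceSK, flat_sliceK]

/-- The flat (Minkowski) tuple: `forcing`. [cite: Ellithy2026, Def. 3.6, p. 21] -/
@[simp] theorem flat_forcing (t r : ℝ) (q : sphere (0 : E3) 1) : flat.forcing t r q = 0 := by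
  simp [ADMTailTuple.forcing, flat_traceSK]

/-- The flat (Minkowski) tuple: `dForcing`. [cite: Ellithy2026, Def. 3.6, p. 21] -/
@[simp] theorem flat_dForcing (t r : ℝ) (p : sphere (0 : E3) 1) : flat.dForcing t r p = 0 := by
  simp [ADMTailTuple.dForcing]

/-- Helper (`curryLeft_zero₂`). [folklore] -/
private theorem curryLeft_zero₂ : (0 : E3 [×2]→L[ℝ] ℝ).curryLeft = 0 := by
  ext x m; simp [ContinuousMultilinearMap.curryLeft_apply]

/-- The flat (Minkowski) tuple: `forcing_fun`. [cite: Ellithy2026, Def. 3.6, p. 21] -/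
theorem flat_forcing_fun (t r : ℝ) : (fun q : sphere (0 : E3) 1 ↦ flat.forcing t r q) = fun _ ↦ 0 :=
  funext (flat_forcing t r)

/-- The flat (Minkowski) tuple: `hessForcing`. [cite: Ellithy2026, Def. 3.6, p. 21] -/
theorem flat_hessForcing (t r : ℝ) (p : sphere (0 : E3) 1) : flat.hessForcing t r p = 0 := by
  simp only [ADMTailTuple.hessForcing, flat_dForcing, map_zero, ContinuousLinearMap.zero_comp, sub_zero,
    flat_forcing_fun, sphereCovDeriv_zero_fun, curryLeft_zero₂, ContinuousLinearMap.comp_zero]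

/-- Differentiability of `y ↦ γ_{S²}(y/‖y‖)` (order-zero stage of `D̸`) away from the origin.
[folklore] -/
private theorem differentiableAt_roundAt_ray {y₀ : E3} (hy₀ : y₀ ≠ 0) (c : ℝ) :
    DifferentiableAt ℝ (fun y : E3 ↦ c • roundAt (‖y‖⁻¹ • y)) y₀ := by
  have hq : DifferentiableAt ℝ (fun y : E3 ↦ ‖y‖⁻¹ • y) y₀ :=
    ((differentiableAt_id.norm ℝ hy₀).inv (norm_ne_zero_iff.mpr hy₀)).smul differentiableAt_id
  let F := E3 →L[ℝ] ℝ
  have hC : DifferentiableAt ℝ (fun y : E3 ↦ ((ContinuousLinearMap.smulRightL ℝ E3 F).comp innerBil) (‖y‖⁻¹ • y)) y₀ :=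
    ((ContinuousLinearMap.smulRightL ℝ E3 F).comp innerBil).differentiableAt.comp y₀ hq
  have hD : DifferentiableAt ℝ (fun y : E3 ↦ innerBil (‖y‖⁻¹ • y)) y₀ :=
    innerBil.differentiableAt.comp y₀ hq
  have hCD := hC.clm_apply hD
  have hround : (fun y : E3 ↦ roundAt (‖y‖⁻¹ • y)) =
      fun y ↦ innerBil - ((ContinuousLinearMap.smulRightL ℝ E3 F).comp innerBil) (‖y‖⁻¹ • y) (innerBil (‖y‖⁻¹ • y)) := by
    funext y
    change roundAt _ = innerBil - (innerSL ℝ (‖y‖⁻¹ • y)).smulRight (innerSL ℝ (‖y‖⁻¹ • y))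
    rfl
  refine DifferentiableAt.const_smul ?_ c
  rw [hround]
  exact (differentiableAt_const _).sub hCD

/-- The flat (Minkowski) tuple: `sphereDiffAt_gammaTan`. [cite: Ellithy2026, Def. 3.6, p. 21] -/
theorem flat_sphereDiffAt_gammaTan (t r : ℝ) (p : sphere (0 : E3) 1) :
    SphereDiffAt 1 (fun q ↦ flat.gammaTan t r q) p := by
  intro j hj
  obtain rfl : j = 0 := Nat.lt_one_iff.mp hj
  simp only [flat_gammaTan, sphereCovDeriv_zero_eq]
  have hev : (fun y : E3 ↦ ContinuousMultilinearMap.uncurry0 ℝ E3 ((r ^ 2) • roundAt (raySphere y : E3))) =ᶠ[𝓝 (p : E3)]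
      fun y ↦ ContinuousMultilinearMap.uncurry0 ℝ E3 ((r ^ 2) • roundAt (‖y‖⁻¹ • y)) :=
    (eventually_ne_nhds (coe_sphere_ne_zero p)).mono fun y hy ↦ by simp only [coe_raySphere' hy]
  refine hev.differentiableAt_iff.mpr ?_
  exact ((continuousMultilinearCurryFin0 ℝ E3 (E3 →L[ℝ] E3 →L[ℝ] ℝ)).symm.toContinuousLinearEquiv.toContinuousLinearMap.differentiableAt).comp
    (p : E3) (differentiableAt_roundAt_ray (coe_sphere_ne_zero p) (r ^ 2))

/-- The flat (Minkowski) tuple: `forcingRegularAt`. [cite: Ellithy2026, Def. 3.6, p. 21] -/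
theorem flat_forcingRegularAt (k : ℕ) (t : ℝ) {r : ℝ} (hr : r ≠ 0) (p : sphere (0 : E3) 1) :
    flat.ForcingRegularAt k t r p := by
  have hy : r • (p : E3) ≠ 0 := smul_ne_zero hr (coe_sphere_ne_zero p)
  refine ⟨?_, ?_, ?_, ?_, flat_sphereDiffAt_gammaTan t r p, ?_, ?_⟩
  · have hev : (fun y ↦ flat.gCart t y) =ᶠ[𝓝 (r • (p : E3))] fun _ ↦ innerBil :=
      (eventually_ne_nhds hy).mono fun y hy' ↦ flat_gCart_eq t hy'
    exact hev.differentiableAt_iff.mpr (differentiableAt_const _)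
  · rw [flat_βCart_fun]; exact differentiableAt_const _
  · rw [show (fun s ↦ flat.gCart s (r • (p : E3))) = fun _ ↦ flat.gCart t (r • (p : E3)) from rfl]
    exact differentiableAt_const _
  · show DifferentiableAt ℝ (fun ρ : ℝ ↦ (ρ ^ 2) • roundAt (p : E3)) r
    fun_prop
  · simp only [flat_bSharp]; exact sphereDiffAt_zero_fun 1 p
  · simp only [flat_forcing]; exact sphereDiffAt_zero_fun k p

/-- The flat (Minkowski) tuple: `X0`. [cite: Ellithy2026, Def. 3.6, p. 21] -/
theorem flat_X0 (Tlo T : ℝ) {σ : ℝ} (hσ : σ ≠ 0) : flat.X0 Tlo σ T = 0 := by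
  have hg : ∀ t, T ≤ t → Tlo < t → ∀ p, flat.ForcingRegularAt 0 t σ p :=
    fun t _ _ p ↦ flat_forcingRegularAt 0 t hσ p
  rw [ADMTailTuple.X0, if_pos hg]
  simp

/-- The flat (Minkowski) tuple: `X1`. [cite: Ellithy2026, Def. 3.6, p. 21] -/
theorem flat_X1 (Tlo T : ℝ) {σ : ℝ} (hσ : σ ≠ 0) : flat.X1 Tlo σ T = 0 := by
  have hg : ∀ t, T ≤ t → Tlo < t → ∀ p, flat.ForcingRegularAt 1 t σ p :=
    fun t _ _ p ↦ flat_forcingRegularAt 1 t hσ p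
  rw [ADMTailTuple.X1, if_pos hg]
  simp

/-- The flat (Minkowski) tuple: `X2`. [cite: Ellithy2026, Def. 3.6, p. 21] -/
theorem flat_X2 (Tlo T : ℝ) {σ : ℝ} (hσ : σ ≠ 0) : flat.X2 Tlo σ T = 0 := by
  have hg : ∀ t, T ≤ t → Tlo < t → ∀ p, flat.ForcingRegularAt 2 t σ p :=
    fun t _ _ p ↦ flat_forcingRegularAt 2 t hσ p
  rw [ADMTailTuple.X2, if_pos hg]
  simp [flat_hessForcing]

/-- The flat (Minkowski) tuple: `hasFiniteForcingTail`. [cite: Ellithy2026, Def. 3.6, p. 21] -/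
theorem flat_hasFiniteForcingTail {r₁ : ℝ} (hr₁ : 0 ≤ r₁) (Tlo T : ℝ) : flat.HasFiniteForcingTail Tlo r₁ T := by
  have hne : ∀ σ, r₁ < σ → σ ≠ 0 := fun σ hσ ↦ ne_of_gt (lt_of_le_of_lt hr₁ hσ)
  have hae0 : ∀ᵐ σ ∂(volume.restrict (Ioi r₁)), flat.X0 Tlo σ T / ENNReal.ofReal σ = 0 := by
    filter_upwards [ae_restrict_mem measurableSet_Ioi] with σ hσ
    rw [flat_X0 Tlo T (hne σ hσ), ENNReal.zero_div]
  have hae1 : ∀ᵐ σ ∂(volume.restrict (Ioi r₁)), flat.X1 Tlo σ T = 0 := by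
    filter_upwards [ae_restrict_mem measurableSet_Ioi] with σ hσ
    rw [flat_X1 Tlo T (hne σ hσ)]
  have hae2 : ∀ᵐ σ ∂(volume.restrict (Ioi r₁)), flat.X2 Tlo σ T = 0 := by
    filter_upwards [ae_restrict_mem measurableSet_Ioi] with σ hσ
    rw [flat_X2 Tlo T (hne σ hσ)]
  refine ⟨fun σ hσ ↦ ?_, ?_, ?_, ?_⟩
  · rw [flat_X0 Tlo T (hne σ hσ), flat_X1 Tlo T (hne σ hσ), flat_X2 Tlo T (hne σ hσ)]
    exact ⟨ENNReal.zero_lt_top, ENNReal.zero_lt_top, ENNReal.zero_lt_top⟩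
  · rw [lintegral_congr_ae hae0, lintegral_zero]; exact ENNReal.zero_lt_top
  · rw [lintegral_congr_ae hae1, lintegral_zero]; exact ENNReal.zero_lt_top
  · rw [lintegral_congr_ae hae2, lintegral_zero]; exact ENNReal.zero_lt_top

/-! ## §7 The inhabitant theorems -/

/-- **The flat tuple is in the class `𝒞𝒮_{-τ}(ℳ_{T̲, r₀})` of Definition 3.6** for every `r₀ ≥ 0`,
every Hölder exponent `α`, every order `τ` and every `T̲`. [cite: Ellithy2026, Def. 3.6, p. 21] -/
theorem flat_isTailCoeff {r₀ : ℝ} (hr₀ : 0 ≤ r₀) (α τ Tlo : ℝ) : flat.IsTailCoeff α τ Tlo r₀ := by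
  refine ⟨flat_isWellFormedOn hr₀ Tlo, fun r₁ hr₁ ↦ ⟨?_, ?_, fun T ↦ ?_⟩⟩
  · rw [flat_tailNormN (hr₀.trans hr₁.le)]; exact ENNReal.zero_lt_top
  · exact flat_isTailNondegenerate (hr₀.trans hr₁.le) Tlo
  · exact flat_hasFiniteForcingTail (hr₀.trans hr₁.le) Tlo T

/-- **The flat tuple is in the strengthened class `𝒞𝒮♯_{-τ}(ℳ_{T̲, r₀})` of Definition 3.8.**
[cite: Ellithy2026, Def. 3.8, p. 22] -/
theorem flat_isSharpTailCoeff {r₀ : ℝ} (hr₀ : 0 ≤ r₀) (α τ Tlo : ℝ) : flat.IsSharpTailCoeff α τ Tlo r₀ := by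
  refine ⟨flat_isTailCoeff hr₀ α τ Tlo, fun r₁ hr₁ ↦ ?_⟩
  rw [flat_sharpTailNormN (hr₀.trans hr₁.le)]; exact ENNReal.zero_lt_top

/-- Non-vacuity of the classes: `𝒞𝒮♯_{-τ}(ℳ) ≠ ∅`. [cite: Ellithy2026, Def. 3.8, p. 22] -/
theorem exists_isSharpTailCoeff {r₀ : ℝ} (hr₀ : 0 ≤ r₀) (α τ Tlo : ℝ) :
    ∃ S : ADMTailTuple, S.IsSharpTailCoeff α τ Tlo r₀ :=
  ⟨flat, flat_isSharpTailCoeff hr₀ α τ Tlo⟩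

/-! ## §9 The static spherically symmetric family and the Schwarzschild tail (first order in `m/r`) -/

/-- Static, spherically symmetric tail tuples: lapse `N = f(r)`, radial coefficient `λ = g(r)`, zero
shifts, zero mixed term, round spheres of areal radius `r`.  `flat` is `radial 1 1`; `schw m` below is
`radial (1 - m/r) (1 + m/r)`, the Schwarzschild exterior of mass `m` to first order in `m/r`.
[cite: Ellithy2026, Remark 4.6, p. 40; Def. 3.6, p. 21] -/
def radial (f g : ℝ → ℝ) : ADMTailTuple where
  N := fun _ r _ ↦ f r
  lam := fun _ r _ ↦ g r
  βr := fun _ _ _ ↦ 0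
  βT := fun _ _ _ ↦ 0
  b := fun _ _ _ ↦ 0
  γ := fun _ r q ↦ (r ^ 2) • roundAt (q : E3)

section Radial

variable (f g : ℝ → ℝ)

/-- The static spherically symmetric family `radial f g`: `N`. [cite: Ellithy2026, Remark 4.6, p. 40; Def. 3.6, p. 21] -/
@[simp] theorem radial_N (t r : ℝ) (p : sphere (0 : E3) 1) : (radial f g).N t r p = f r := rfl
/-- The static spherically symmetric family `radial f g`: `lam`. [cite: Ellithy2026, Remark 4.6, p. 40; Def. 3.6, p. 21] -/
@[simp] theorem radial_lam (t r : ℝ) (p : sphere (0 : E3) 1) : (radial f g).lam t r p = g r := rfl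
/-- The static spherically symmetric family `radial f g`: `βr`. [cite: Ellithy2026, Remark 4.6, p. 40; Def. 3.6, p. 21] -/
@[simp] theorem radial_βr (t r : ℝ) (p : sphere (0 : E3) 1) : (radial f g).βr t r p = 0 := rfl
/-- The static spherically symmetric family `radial f g`: `βT`. [cite: Ellithy2026, Remark 4.6, p. 40; Def. 3.6, p. 21] -/
@[simp] theorem radial_βT (t r : ℝ) (p : sphere (0 : E3) 1) : (radial f g).βT t r p = 0 := rfl
/-- The static spherically symmetric family `radial f g`: `b`. [cite: Ellithy2026, Remark 4.6, p. 40; Def. 3.6, p. 21] -/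
@[simp] theorem radial_b (t r : ℝ) (p : sphere (0 : E3) 1) : (radial f g).b t r p = 0 := rfl
/-- The static spherically symmetric family `radial f g`: `γ`. [cite: Ellithy2026, Remark 4.6, p. 40; Def. 3.6, p. 21] -/
@[simp] theorem radial_γ (t r : ℝ) (p : sphere (0 : E3) 1) : (radial f g).γ t r p = (r ^ 2) • roundAt (p : E3) := rfl

/-! The angular sector of `radial f g` is literally that of `flat` (definitional equalities). -/
/-- The static spherically symmetric family `radial f g`: `gammaTan`. [cite: Ellithy2026, Remark 4.6, p. 40; Def. 3.6, p. 21] -/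
theorem radial_gammaTan : (radial f g).gammaTan = flat.gammaTan := rfl
/-- The static spherically symmetric family `radial f g`: `gammaHat`. [cite: Ellithy2026, Remark 4.6, p. 40; Def. 3.6, p. 21] -/
theorem radial_gammaHat : (radial f g).gammaHat = flat.gammaHat := rfl
/-- The static spherically symmetric family `radial f g`: `gammaNormSq`. [cite: Ellithy2026, Remark 4.6, p. 40; Def. 3.6, p. 21] -/
theorem radial_gammaNormSq : (radial f g).gammaNormSq = flat.gammaNormSq := rfl
/-- The static spherically symmetric family `radial f g`: `gammaNormSqBilin`. [cite: Ellithy2026, Remark 4.6, p. 40; Def. 3.6, p. 21] -/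
theorem radial_gammaNormSqBilin : (radial f g).gammaNormSqBilin = flat.gammaNormSqBilin := rfl
/-- The static spherically symmetric family `radial f g`: `gammaTrace`. [cite: Ellithy2026, Remark 4.6, p. 40; Def. 3.6, p. 21] -/
theorem radial_gammaTrace : (radial f g).gammaTrace = flat.gammaTrace := rfl
/-- The static spherically symmetric family `radial f g`: `bSharp`. [cite: Ellithy2026, Remark 4.6, p. 40; Def. 3.6, p. 21] -/
theorem radial_bSharp : (radial f g).bSharp = flat.bSharp := rfl
/-- The static spherically symmetric family `radial f g`: `dGammaDr`. [cite: Ellithy2026, Remark 4.6, p. 40; Def. 3.6, p. 21] -/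
theorem radial_dGammaDr : (radial f g).dGammaDr = flat.dGammaDr := rfl
/-- The static spherically symmetric family `radial f g`: `lieBSharpGamma`. [cite: Ellithy2026, Remark 4.6, p. 40; Def. 3.6, p. 21] -/
theorem radial_lieBSharpGamma : (radial f g).lieBSharpGamma = flat.lieBSharpGamma := rfl
/-- The static spherically symmetric family `radial f g`: `gammaDev`. [cite: Ellithy2026, Remark 4.6, p. 40; Def. 3.6, p. 21] -/
theorem radial_gammaDev : (radial f g).gammaDev = flat.gammaDev := rfl
/-- The static spherically symmetric family `radial f g`: `βCart_apply`. [cite: Ellithy2026, Remark 4.6, p. 40; Def. 3.6, p. 21] -/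
theorem radial_βCart_apply (t : ℝ) (y : E3) : (radial f g).βCart t y = 0 := flat_βCart t y
/-- The static spherically symmetric family `radial f g`: `shift`. [cite: Ellithy2026, Remark 4.6, p. 40; Def. 3.6, p. 21] -/
theorem radial_shift : (radial f g).shift = fun _ _ _ ↦ 0 := flat_shift
/-- The static spherically symmetric family `radial f g`: `b_fun`. [cite: Ellithy2026, Remark 4.6, p. 40; Def. 3.6, p. 21] -/
theorem radial_b_fun : (radial f g).b = fun _ _ _ ↦ 0 := rfl
/-- The static spherically symmetric family `radial f g`: `lapseDev`. [cite: Ellithy2026, Remark 4.6, p. 40; Def. 3.6, p. 21] -/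
theorem radial_lapseDev : (radial f g).lapseDev = fun _ r _ ↦ f r - 1 := rfl
/-- The static spherically symmetric family `radial f g`: `lamDev`. [cite: Ellithy2026, Remark 4.6, p. 40; Def. 3.6, p. 21] -/
theorem radial_lamDev : (radial f g).lamDev = fun _ r _ ↦ g r - 1 := rfl

/-- The static spherically symmetric family `radial f g`: `isWellFormedOn`. [cite: Ellithy2026, Remark 4.6, p. 40; Def. 3.6, p. 21] -/
theorem radial_isWellFormedOn {r₀ : ℝ} (hr₀ : 0 ≤ r₀) (Tlo : ℝ) : (radial f g).IsWellFormedOn Tlo r₀ :=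
  flat_isWellFormedOn hr₀ Tlo

/-- The static spherically symmetric family `radial f g`: `meanCurv`. [cite: Ellithy2026, Remark 4.6, p. 40; Def. 3.6, p. 21] -/
theorem radial_meanCurv (t r : ℝ) (p : sphere (0 : E3) 1) : (radial f g).meanCurv t r p =
    (2 * g r)⁻¹ * flat.gammaTrace t r p (flat.dGammaDr t r p - flat.lieBSharpGamma t r p) := rfl

/-- `r H_{t,r} = 2 / λ(r)` for the static family.
[cite: Ellithy2026, Remark 4.6, p. 40; Def. 3.6, p. 21] -/
theorem radial_r_mul_meanCurv {r : ℝ} (hr : r ≠ 0) (t : ℝ) (p : sphere (0 : E3) 1) :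
    r * (radial f g).meanCurv t r p = 2 / g r := by
  rw [radial_meanCurv, flat_gammaTrace hr]
  rcases eq_or_ne (g r) 0 with h | h
  · simp [h]
  · field_simp; ring

/-- The static spherically symmetric family `radial f g`: `isTailNondegenerate`. [cite: Ellithy2026, Remark 4.6, p. 40; Def. 3.6, p. 21] -/
theorem radial_isTailNondegenerate {r₁ δ ϑ : ℝ} (hr₁ : 0 ≤ r₁) (hδ : 0 < δ) (hϑ : 0 < ϑ)
    (hg : ∀ r, r₁ < r → δ ≤ g r ∧ g r ≤ δ⁻¹) (hf : ∀ r, r₁ < r → ϑ ≤ f r ∧ f r ≤ ϑ⁻¹) (Tlo : ℝ) :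
    (radial f g).IsTailNondegenerate Tlo r₁ := by
  refine ⟨δ, ϑ, δ / 2, hδ, hϑ, by positivity, fun t r p _ hr ↦ ?_⟩
  have hr0 : r ≠ 0 := ne_of_gt (lt_of_le_of_lt hr₁ hr)
  obtain ⟨hg1, hg2⟩ := hg r hr
  obtain ⟨hf1, hf2⟩ := hf r hr
  have hgpos : 0 < g r := lt_of_lt_of_le hδ hg1
  have hH := radial_r_mul_meanCurv f g hr0 t p
  have h0 : (radial f g).gammaNormSq t r p 0 = 0 := by
    rw [radial_gammaNormSq]; exact flat_gammaNormSq_zero t r p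
  simp only [radial_lam, radial_N, radial_βT, h0, add_zero, hH]
  refine ⟨hg2, hg1, hf2, le_rfl, hf1, ?_, ?_⟩
  · rw [inv_div, ge_iff_le]
    exact div_le_div_of_nonneg_left (by norm_num) hδ hg1
  · rw [ge_iff_le, le_div_iff₀ hgpos]
    have : δ * g r ≤ 1 := by
      calc δ * g r ≤ δ * δ⁻¹ := mul_le_mul_of_nonneg_left hg2 hδ.le
        _ = 1 := mul_inv_cancel₀ hδ.ne'
    linarith

/-! ### The forcing of the static family vanishes -/

/-- The static spherically symmetric family `radial f g`: `sliceK`. [cite: Ellithy2026, Remark 4.6, p. 40; Def. 3.6, p. 21] -/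
theorem radial_sliceK (t : ℝ) (y : E3) : (radial f g).sliceK t y = 0 := by
  have h1 : deriv (fun s ↦ (radial f g).gCart s y) t = 0 := by
    rw [show (fun s ↦ (radial f g).gCart s y) = fun _ ↦ (radial f g).gCart t y from rfl, deriv_const]
  have h2 : fderiv ℝ (fun z ↦ (radial f g).βCart t z) y = 0 := by
    simp only [radial_βCart_apply]; simp
  simp only [ADMTailTuple.sliceK, h1, h2]
  simp only [radial_βCart_apply, map_zero, ContinuousLinearMap.zero_comp, sub_zero,
    ContinuousLinearMap.flip_zero, smul_zero]

/-- The static spherically symmetric family `radial f g`: `traceSK`. [cite: Ellithy2026, Remark 4.6, p. 40; Def. 3.6, p. 21] -/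
theorem radial_traceSK (t : ℝ) (y : E3) : (radial f g).traceSK t y = 0 := by
  simp [ADMTailTuple.traceSK, radial_sliceK]

/-- The static spherically symmetric family `radial f g`: `forcing`. [cite: Ellithy2026, Remark 4.6, p. 40; Def. 3.6, p. 21] -/
@[simp] theorem radial_forcing (t r : ℝ) (q : sphere (0 : E3) 1) : (radial f g).forcing t r q = 0 := by
  simp [ADMTailTuple.forcing, radial_traceSK]

/-- The static spherically symmetric family `radial f g`: `forcing_fun`. [cite: Ellithy2026, Remark 4.6, p. 40; Def. 3.6, p. 21] -/
theorem radial_forcing_fun (t r : ℝ) : (fun q : sphere (0 : E3) 1 ↦ (radial f g).forcing t r q) = fun _ ↦ 0 :=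
  funext (radial_forcing f g t r)

/-- The static spherically symmetric family `radial f g`: `dForcing`. [cite: Ellithy2026, Remark 4.6, p. 40; Def. 3.6, p. 21] -/
@[simp] theorem radial_dForcing (t r : ℝ) (p : sphere (0 : E3) 1) : (radial f g).dForcing t r p = 0 := by
  simp [ADMTailTuple.dForcing]

/-- The static spherically symmetric family `radial f g`: `hessForcing`. [cite: Ellithy2026, Remark 4.6, p. 40; Def. 3.6, p. 21] -/
theorem radial_hessForcing (t r : ℝ) (p : sphere (0 : E3) 1) : (radial f g).hessForcing t r p = 0 := by
  simp only [ADMTailTuple.hessForcing, radial_dForcing, map_zero, ContinuousLinearMap.zero_comp, sub_zero,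
    radial_forcing_fun, sphereCovDeriv_zero_fun, curryLeft_zero₂, ContinuousLinearMap.comp_zero]

/-- The slice metric of `radial f g` in the Cartesian chart, away from the origin:
`g(t)_y = ⟪·,·⟫ + (λ(|y|)² - 1) |y|⁻² ⟪y,·⟫⟪y,·⟫`.
[cite: Ellithy2026, Remark 4.6, p. 40; Def. 3.6, p. 21] -/
theorem radial_gCart_eq (t : ℝ) {y : E3} (hy : y ≠ 0) :
    (radial f g).gCart t y =
      innerBil + ((g ‖y‖ ^ 2 - 1) * (‖y‖ ^ 2)⁻¹) • (innerSL ℝ y).smulRight (innerSL ℝ y) := by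
  have hn : ‖y‖ ≠ 0 := norm_ne_zero_iff.mpr hy
  refine ContinuousLinearMap.ext fun X ↦ ContinuousLinearMap.ext fun Y ↦ ?_
  have h0 : (radial f g).gammaNormSq t ‖y‖ (raySphere y) 0 = 0 := by
    rw [radial_gammaNormSq]; exact flat_gammaNormSq_zero _ _ _
  simp [ADMTailTuple.gCart, ADMTailTuple.angVel, h0, coe_raySphere' hy, real_inner_smul_left,
    real_inner_smul_right, real_inner_comm, ContinuousLinearMap.smulRight_apply]
  simp only [inner_sub_right, real_inner_smul_right, real_inner_self_eq_norm_sq, real_inner_comm X y,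
    real_inner_comm Y y]
  field_simp
  ring

/-- Helper (`differentiableAt_radial_gCart`). [folklore] -/
private theorem differentiableAt_radial_gCart (t : ℝ) {y₀ : E3} (hy₀ : y₀ ≠ 0) (hg : DifferentiableAt ℝ g ‖y₀‖) :
    DifferentiableAt ℝ (fun y ↦ (radial f g).gCart t y) y₀ := by
  have hev : (fun y ↦ (radial f g).gCart t y) =ᶠ[𝓝 y₀]
      fun y ↦ innerBil + ((g ‖y‖ ^ 2 - 1) * (‖y‖ ^ 2)⁻¹) • (innerSL ℝ y).smulRight (innerSL ℝ y) :=
    (eventually_ne_nhds hy₀).mono fun y hy ↦ radial_gCart_eq f g t hy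
  refine hev.differentiableAt_iff.mpr ?_
  have hn : DifferentiableAt ℝ (fun y : E3 ↦ ‖y‖) y₀ := differentiableAt_id.norm ℝ hy₀
  have hφ : DifferentiableAt ℝ (fun y : E3 ↦ (g ‖y‖ ^ 2 - 1) * (‖y‖ ^ 2)⁻¹) y₀ :=
    (((hg.comp y₀ hn).pow 2).sub_const 1).mul ((hn.pow 2).inv (pow_ne_zero 2 (norm_ne_zero_iff.mpr hy₀)))
  let F := E3 →L[ℝ] ℝ
  have hB : DifferentiableAt ℝ
      (fun y : E3 ↦ ((ContinuousLinearMap.smulRightL ℝ E3 F).comp innerBil) y (innerBil y)) y₀ :=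
    ((ContinuousLinearMap.smulRightL ℝ E3 F).comp innerBil).differentiableAt.clm_apply innerBil.differentiableAt
  change DifferentiableAt ℝ (fun y ↦ innerBil +
    ((g ‖y‖ ^ 2 - 1) * (‖y‖ ^ 2)⁻¹) • ((ContinuousLinearMap.smulRightL ℝ E3 F).comp innerBil) y (innerBil y)) y₀
  exact (differentiableAt_const _).add (hφ.smul hB)

/-- The static spherically symmetric family `radial f g`: `forcingRegularAt`. [cite: Ellithy2026, Remark 4.6, p. 40; Def. 3.6, p. 21] -/
theorem radial_forcingRegularAt (k : ℕ) (t : ℝ) {r : ℝ} (hr : 0 < r) (hg : DifferentiableAt ℝ g r)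
    (p : sphere (0 : E3) 1) : (radial f g).ForcingRegularAt k t r p := by
  have hy : r • (p : E3) ≠ 0 := smul_ne_zero hr.ne' (coe_sphere_ne_zero p)
  have hnorm : ‖r • (p : E3)‖ = r := by
    rw [norm_smul, norm_coe_sphere, mul_one, Real.norm_of_nonneg hr.le]
  refine ⟨?_, ?_, ?_, ?_, flat_sphereDiffAt_gammaTan t r p, ?_, ?_⟩
  · refine differentiableAt_radial_gCart f g t hy ?_
    rw [hnorm]; exact hg
  · simp only [radial_βCart_apply]; exact differentiableAt_const _
  · rw [show (fun s ↦ (radial f g).gCart s (r • (p : E3))) = fun _ ↦ (radial f g).gCart t (r • (p : E3)) from rfl]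
    exact differentiableAt_const _
  · show DifferentiableAt ℝ (fun ρ : ℝ ↦ (ρ ^ 2) • roundAt (p : E3)) r
    fun_prop
  · rw [radial_bSharp]; simp only [flat_bSharp]; exact sphereDiffAt_zero_fun 1 p
  · simp only [radial_forcing]; exact sphereDiffAt_zero_fun k p

/-- The static spherically symmetric family `radial f g`: `X0`. [cite: Ellithy2026, Remark 4.6, p. 40; Def. 3.6, p. 21] -/
theorem radial_X0 (Tlo T : ℝ) {σ : ℝ} (hσ : 0 < σ) (hg : DifferentiableAt ℝ g σ) : (radial f g).X0 Tlo σ T = 0 := by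
  have hG : ∀ t, T ≤ t → Tlo < t → ∀ p, (radial f g).ForcingRegularAt 0 t σ p :=
    fun t _ _ p ↦ radial_forcingRegularAt f g 0 t hσ hg p
  rw [ADMTailTuple.X0, if_pos hG]
  simp

/-- The static spherically symmetric family `radial f g`: `X1`. [cite: Ellithy2026, Remark 4.6, p. 40; Def. 3.6, p. 21] -/
theorem radial_X1 (Tlo T : ℝ) {σ : ℝ} (hσ : 0 < σ) (hg : DifferentiableAt ℝ g σ) : (radial f g).X1 Tlo σ T = 0 := by
  have hG : ∀ t, T ≤ t → Tlo < t → ∀ p, (radial f g).ForcingRegularAt 1 t σ p :=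
    fun t _ _ p ↦ radial_forcingRegularAt f g 1 t hσ hg p
  rw [ADMTailTuple.X1, if_pos hG]
  simp [radial_gammaNormSq]

/-- The static spherically symmetric family `radial f g`: `X2`. [cite: Ellithy2026, Remark 4.6, p. 40; Def. 3.6, p. 21] -/
theorem radial_X2 (Tlo T : ℝ) {σ : ℝ} (hσ : 0 < σ) (hg : DifferentiableAt ℝ g σ) : (radial f g).X2 Tlo σ T = 0 := by
  have hG : ∀ t, T ≤ t → Tlo < t → ∀ p, (radial f g).ForcingRegularAt 2 t σ p :=
    fun t _ _ p ↦ radial_forcingRegularAt f g 2 t hσ hg p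
  rw [ADMTailTuple.X2, if_pos hG]
  simp [radial_hessForcing, radial_gammaNormSqBilin]

/-- The static spherically symmetric family `radial f g`: `hasFiniteForcingTail`. [cite: Ellithy2026, Remark 4.6, p. 40; Def. 3.6, p. 21] -/
theorem radial_hasFiniteForcingTail {r₁ : ℝ} (hr₁ : 0 ≤ r₁) (hg : ∀ ρ, r₁ < ρ → DifferentiableAt ℝ g ρ)
    (Tlo T : ℝ) : (radial f g).HasFiniteForcingTail Tlo r₁ T := by
  have hpos : ∀ σ, r₁ < σ → 0 < σ := fun σ hσ ↦ lt_of_le_of_lt hr₁ hσ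
  have hae0 : ∀ᵐ σ ∂(volume.restrict (Ioi r₁)), (radial f g).X0 Tlo σ T / ENNReal.ofReal σ = 0 := by
    filter_upwards [ae_restrict_mem measurableSet_Ioi] with σ hσ
    rw [radial_X0 f g Tlo T (hpos σ hσ) (hg σ hσ), ENNReal.zero_div]
  have hae1 : ∀ᵐ σ ∂(volume.restrict (Ioi r₁)), (radial f g).X1 Tlo σ T = 0 := by
    filter_upwards [ae_restrict_mem measurableSet_Ioi] with σ hσ
    rw [radial_X1 f g Tlo T (hpos σ hσ) (hg σ hσ)]
  have hae2 : ∀ᵐ σ ∂(volume.restrict (Ioi r₁)), (radial f g).X2 Tlo σ T = 0 := by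
    filter_upwards [ae_restrict_mem measurableSet_Ioi] with σ hσ
    rw [radial_X2 f g Tlo T (hpos σ hσ) (hg σ hσ)]
  refine ⟨fun σ hσ ↦ ?_, ?_, ?_, ?_⟩
  · rw [radial_X0 f g Tlo T (hpos σ hσ) (hg σ hσ), radial_X1 f g Tlo T (hpos σ hσ) (hg σ hσ),
      radial_X2 f g Tlo T (hpos σ hσ) (hg σ hσ)]
    exact ⟨ENNReal.zero_lt_top, ENNReal.zero_lt_top, ENNReal.zero_lt_top⟩
  · rw [lintegral_congr_ae hae0, lintegral_zero]; exact ENNReal.zero_lt_top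
  · rw [lintegral_congr_ae hae1, lintegral_zero]; exact ENNReal.zero_lt_top
  · rw [lintegral_congr_ae hae2, lintegral_zero]; exact ENNReal.zero_lt_top

end Radial

/-! ## §10 Tail norms of spherically symmetric (angle-independent), static profiles -/

section Profile

open scoped Nat

variable {W : Type*} [NormedAddCommGroup W] [NormedSpace ℝ W]

/-- Helper (`sphereCovDeriv_succ_const`). [folklore] -/
private theorem sphereCovDeriv_succ_const (k : ℕ) (w : W) (p : sphere (0 : E3) 1) :
    sphereCovDeriv (k + 1) (fun _ : sphere (0 : E3) 1 ↦ w) p = 0 := by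
  induction k generalizing p with
  | zero =>
    ext m
    rw [sphereCovDeriv_succ_apply]
    simp only [sphereCovDeriv_zero_eq]
    simp
  | succ k ih =>
    ext m
    rw [sphereCovDeriv_succ_apply]
    simp [ih]

/-- Helper (`sphereDiffAt_const`). [folklore] -/
private theorem sphereDiffAt_const (k : ℕ) (w : W) (p : sphere (0 : E3) 1) :
    SphereDiffAt k (fun _ : sphere (0 : E3) 1 ↦ w) p := by
  intro j _
  cases j with
  | zero => simp only [sphereCovDeriv_zero_eq]; exact differentiableAt_const _
  | succ j => simp only [sphereCovDeriv_succ_const]; exact differentiableAt_const _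

/-- The order-zero curry isometry `W ≃ (E3 [×0]→L W)` as a continuous linear equivalence.
[folklore] -/
def unc0 : W ≃L[ℝ] (E3 [×0]→L[ℝ] W) := (continuousMultilinearCurryFin0 ℝ E3 W).symm.toContinuousLinearEquiv

/-- Helper (`unc0_apply`). [folklore] -/
private theorem unc0_apply (w : W) :
    (unc0 : W ≃L[ℝ] (E3 [×0]→L[ℝ] W)) w = ContinuousMultilinearMap.uncurry0 ℝ E3 w := rfl

/-- Helper (`iteratedDeriv_uncurry0`). [folklore] -/
private theorem iteratedDeriv_uncurry0 (u : ℝ → W) (n : ℕ) (x : ℝ) :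
    iteratedDeriv n (fun ρ ↦ ContinuousMultilinearMap.uncurry0 ℝ E3 (u ρ)) x =
      ContinuousMultilinearMap.uncurry0 ℝ E3 (iteratedDeriv n u x) := by
  have h : (fun ρ ↦ ContinuousMultilinearMap.uncurry0 ℝ E3 (u ρ)) =
      (unc0 : W ≃L[ℝ] (E3 [×0]→L[ℝ] W)) ∘ u := rfl
  rw [h, iteratedDeriv_eq_iteratedFDeriv, ContinuousLinearEquiv.iteratedFDeriv_comp_left,
    iteratedDeriv_eq_iteratedFDeriv]
  rfl

/-- Helper (`iteratedDeriv_uncurry0_fun`). [folklore] -/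
private theorem iteratedDeriv_uncurry0_fun (u : ℝ → W) (n : ℕ) :
    iteratedDeriv n (fun ρ ↦ ContinuousMultilinearMap.uncurry0 ℝ E3 (u ρ)) =
      fun x ↦ ContinuousMultilinearMap.uncurry0 ℝ E3 (iteratedDeriv n u x) :=
  funext (iteratedDeriv_uncurry0 u n)

/-- Helper (`differentiableAt_uncurry0_comp_iff`). [folklore] -/
private theorem differentiableAt_uncurry0_comp_iff {u : ℝ → W} {x : ℝ} :
    DifferentiableAt ℝ (fun ρ ↦ ContinuousMultilinearMap.uncurry0 ℝ E3 (u ρ)) x ↔ DifferentiableAt ℝ u x :=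
  (unc0 : W ≃L[ℝ] (E3 [×0]→L[ℝ] W)).comp_differentiableAt_iff

/-- Helper (`angPart_succ_pconst`). [folklore] -/
private theorem angPart_succ_pconst (k : ℕ) (u : ℝ → W) :
    angPart (k + 1) (fun r (_ : sphere (0 : E3) 1) ↦ u r) = fun _ _ ↦ 0 := by
  funext r p; exact sphereCovDeriv_succ_const k (u r) p

/-- Helper (`radAngPart_succ_pconst`). [folklore] -/
private theorem radAngPart_succ_pconst (ℓ j : ℕ) (u : ℝ → W) :
    radAngPart ℓ (j + 1) (fun r (_ : sphere (0 : E3) 1) ↦ u r) = fun _ _ ↦ 0 := by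
  funext r p
  simp only [radAngPart, sphereCovDeriv_succ_const]
  exact congrFun (iteratedDeriv_zero_fun ℓ) r

/-- Helper (`radAngPart_zero_pconst`). [folklore] -/
private theorem radAngPart_zero_pconst (ℓ : ℕ) (u : ℝ → W) :
    radAngPart ℓ 0 (fun r (_ : sphere (0 : E3) 1) ↦ u r) =
      fun r _ ↦ ContinuousMultilinearMap.uncurry0 ℝ E3 (iteratedDeriv ℓ u r) := by
  funext r p
  simp only [radAngPart, sphereCovDeriv_zero_eq]
  exact iteratedDeriv_uncurry0 u ℓ r

omit [NormedSpace ℝ W] in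
/-- Sup bound for an angle-independent tail function. [cite: Ellithy2026, Defs. 3.1–3.4, p. 20] -/
theorem tailSupNorm_pconst_le {J : Set ℝ} {u : ℝ → W} {B : ℝ} (hB : ∀ r ∈ J, ‖u r‖ ≤ B) :
    tailSupNorm J (fun r (_ : sphere (0 : E3) 1) ↦ u r) ≤ ENNReal.ofReal B := by
  refine iSup₂_le fun r hr ↦ iSup_le fun _ ↦ ?_
  rw [← ofReal_norm]
  exact ENNReal.ofReal_le_ofReal (hB r hr)

omit [NormedSpace ℝ W] in
/-- **Parabolic Hölder bound for angle-independent tail functions.**  If `u` is bounded by `B` and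
`L`-Lipschitz in `s = log r` on `J ⊆ (0, ∞)`, then `[u]_{α,α/2;M_J} ≤ max(L, 2B)` (`0 < α ≤ 2`):
for `|s - s'| ≤ 1` use the Lipschitz bound and `|s-s'| ≤ |s-s'|^{α/2} ≤ d_p^α`, else the sup bound.
[cite: Ellithy2026, Defs. 3.1–3.4, p. 20] -/
theorem tailHolderSeminorm_pconst_le {J : Set ℝ} (hJ : J ⊆ Ioi 0) {α : ℝ} (hα : 0 < α) (hα2 : α ≤ 2)
    {u : ℝ → W} {B L : ℝ} (hB0 : 0 ≤ B) (hL0 : 0 ≤ L) (hB : ∀ r ∈ J, ‖u r‖ ≤ B)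
    (hL : ∀ r ∈ J, ∀ r' ∈ J, ‖u r - u r'‖ ≤ L * |Real.log r - Real.log r'|) :
    tailHolderSeminorm α J (fun r (_ : sphere (0 : E3) 1) ↦ u r) ≤ ENNReal.ofReal (max L (2 * B)) := by
  refine iSup_le fun z ↦ iSup_le fun z' ↦ iSup_le fun hz ↦ iSup_le fun hz' ↦ iSup_le fun _ ↦ ?_
  have hM0 : 0 ≤ max L (2 * B) := le_max_of_le_left hL0
  by_cases hr : z.1 = z'.1
  · have h0 : u z.1 - u z'.1 = 0 := by rw [hr, sub_self]
    simp [h0]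
  · set x := |Real.log z.1 - Real.log z'.1| with hx
    have hx0 : 0 < x :=
      abs_pos.mpr (sub_ne_zero.mpr fun h ↦ hr (Real.log_injOn_pos (hJ hz) (hJ hz') h))
    have hd : Real.sqrt x ≤ logParabolicDist z z' := by
      have := InnerProductGeometry.angle_nonneg (z.2 : E3) (z'.2 : E3)
      simp only [logParabolicDist, hx]; linarith
    have hdpos : 0 < logParabolicDist z z' := lt_of_lt_of_le (Real.sqrt_pos.mpr hx0) hd
    have hxa : x ^ (α / 2) ≤ logParabolicDist z z' ^ α := by
      calc x ^ (α / 2) = (Real.sqrt x) ^ α := by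
              rw [Real.sqrt_eq_rpow, ← Real.rpow_mul hx0.le]; congr 1; ring
        _ ≤ logParabolicDist z z' ^ α := Real.rpow_le_rpow (Real.sqrt_nonneg _) hd hα.le
    have hnum : ‖u z.1 - u z'.1‖ ≤ max L (2 * B) * x ^ (α / 2) := by
      rcases le_or_gt x 1 with hx1 | hx1
      · have hxx : x ≤ x ^ (α / 2) := by
          calc x = x ^ (1 : ℝ) := (Real.rpow_one x).symm
            _ ≤ x ^ (α / 2) := Real.rpow_le_rpow_of_exponent_ge hx0 hx1 (by linarith)
        calc ‖u z.1 - u z'.1‖ ≤ L * x := hL _ hz _ hz'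
          _ ≤ L * x ^ (α / 2) := mul_le_mul_of_nonneg_left hxx hL0
          _ ≤ max L (2 * B) * x ^ (α / 2) :=
            mul_le_mul_of_nonneg_right (le_max_left _ _) (Real.rpow_nonneg hx0.le _)
      · have h1x : 1 ≤ x ^ (α / 2) := Real.one_le_rpow hx1.le (by linarith)
        calc ‖u z.1 - u z'.1‖ ≤ ‖u z.1‖ + ‖u z'.1‖ := norm_sub_le _ _
          _ ≤ 2 * B := by linarith [hB _ hz, hB _ hz']
          _ ≤ 2 * B * x ^ (α / 2) := le_mul_of_one_le_right (by linarith) h1x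
          _ ≤ max L (2 * B) * x ^ (α / 2) :=
            mul_le_mul_of_nonneg_right (le_max_right _ _) (Real.rpow_nonneg hx0.le _)
    have hne0 : ENNReal.ofReal (logParabolicDist z z' ^ α) ≠ 0 := by
      rw [Ne, ENNReal.ofReal_eq_zero, not_le]; exact Real.rpow_pos_of_pos hdpos α
    rw [ENNReal.div_le_iff hne0 ENNReal.ofReal_ne_top, ← ofReal_norm, ← ENNReal.ofReal_mul hM0]
    exact ENNReal.ofReal_le_ofReal (hnum.trans (mul_le_mul_of_nonneg_left hxa hM0))

/-- Sup bound for the power profile `A r^θ`, `θ ≤ 0`, on `r > r₁ > 0`. [folklore] -/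
private theorem norm_rpow_profile_le {A θ r₁ : ℝ} (hr₁ : 0 < r₁) (hθ : θ ≤ 0) {r : ℝ} (hr : r₁ < r) :
    ‖A * r ^ θ‖ ≤ |A| * r₁ ^ θ := by
  rw [Real.norm_eq_abs, abs_mul, abs_of_nonneg (Real.rpow_nonneg (hr₁.le.trans hr.le) θ)]
  exact mul_le_mul_of_nonneg_left (Real.rpow_le_rpow_of_nonpos hr₁ hr.le hθ) (abs_nonneg A)

/-- Lipschitz bound in `s = log r` for the power profile `A r^θ = A e^{θ s}`, `θ ≤ 0`, on `r > r₁ > 0`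
(mean value theorem in `s`). [folklore] -/
private theorem rpow_profile_lip {A θ r₁ : ℝ} (hr₁ : 0 < r₁) (hθ : θ ≤ 0) {r r' : ℝ} (hr : r₁ < r) (hr' : r₁ < r') :
    ‖A * r ^ θ - A * r' ^ θ‖ ≤ |A| * |θ| * r₁ ^ θ * |Real.log r - Real.log r'| := by
  have hr0 : 0 < r := hr₁.trans hr
  have hr0' : 0 < r' := hr₁.trans hr'
  have hG : ∀ s, HasDerivAt (fun s ↦ A * Real.exp (θ * s)) (A * (Real.exp (θ * s) * θ)) s := by
    intro s
    have h1 : HasDerivAt (fun s ↦ θ * s) θ s := by simpa using (hasDerivAt_id s).const_mul θ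
    exact ((Real.hasDerivAt_exp (θ * s)).comp s h1).const_mul A
  have hdiff : ∀ s ∈ Ioi (Real.log r₁), DifferentiableAt ℝ (fun s ↦ A * Real.exp (θ * s)) s :=
    fun s _ ↦ (hG s).differentiableAt
  have hbound : ∀ s ∈ Ioi (Real.log r₁), ‖deriv (fun s ↦ A * Real.exp (θ * s)) s‖ ≤ |A| * |θ| * r₁ ^ θ := by
    intro s hs
    rw [(hG s).deriv, Real.norm_eq_abs, abs_mul, abs_mul, abs_of_pos (Real.exp_pos _)]
    have hexp : Real.exp (θ * s) ≤ r₁ ^ θ := by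
      rw [Real.rpow_def_of_pos hr₁, mul_comm (Real.log r₁)]
      exact Real.exp_le_exp.mpr (mul_le_mul_of_nonpos_left (le_of_lt hs) hθ)
    calc |A| * (Real.exp (θ * s) * |θ|) = |A| * |θ| * Real.exp (θ * s) := by ring
      _ ≤ |A| * |θ| * r₁ ^ θ := mul_le_mul_of_nonneg_left hexp (by positivity)
  have key := (convex_Ioi (Real.log r₁)).norm_image_sub_le_of_norm_deriv_le hdiff hbound
    (Real.log_lt_log hr₁ hr') (Real.log_lt_log hr₁ hr)
  have hGr : ∀ {ρ : ℝ}, 0 < ρ → A * Real.exp (θ * Real.log ρ) = A * ρ ^ θ := by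
    intro ρ hρ; rw [Real.rpow_def_of_pos hρ, mul_comm (Real.log ρ)]
  simpa only [hGr hr0, hGr hr0', Real.norm_eq_abs] using key

/-- **The weighted `C^{2+α,1+α/2}_{-σ}` norm of the mass profile `A/r` on a tail `r > r₁ > 0` is finite
for every weight `σ ≤ 1`** (the weighted profile is `A r^{σ-1}`, its `s`-derivative `A(1-σ) r^{σ-1}`).
[cite: Ellithy2026, Defs. 3.1–3.4, p. 20] -/
theorem ctNorm_inv_profile_lt_top {α σ r₁ : ℝ} (hα : 0 < α) (hα2 : α ≤ 2) (hσ : σ ≤ 1) (hr₁ : 0 < r₁)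
    (A : ℝ) : ctWeightedNorm α σ (Ioi r₁) (fun r (_ : sphere (0 : E3) 1) ↦ A * r⁻¹) < ⊤ := by
  set J := Ioi r₁ with hJdef
  have hJ : J ⊆ Ioi 0 := fun r hr ↦ hr₁.trans hr
  set u : ℝ → ℝ := fun r ↦ r ^ σ • (A * r⁻¹) with hudef
  have hW : rpowWeight σ (fun r (_ : sphere (0 : E3) 1) ↦ A * r⁻¹) = fun r _ ↦ u r := rfl
  have hu : ∀ r ∈ J, u r = A * r ^ (σ - 1) := by
    intro r hr
    have hr0 : (r : ℝ) ≠ 0 := (hr₁.trans hr).ne'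
    simp only [hudef, smul_eq_mul, Real.rpow_sub_one hr0]
    field_simp
  have hu_ev : ∀ r ∈ J, u =ᶠ[𝓝 r] fun ρ ↦ A * ρ ^ (σ - 1) := fun r hr ↦
    Filter.eventuallyEq_of_mem (isOpen_Ioi.mem_nhds hr) fun ρ hρ ↦ hu ρ hρ
  have hderiv : ∀ r ∈ J, HasDerivAt (fun ρ : ℝ ↦ A * ρ ^ (σ - 1)) (A * ((σ - 1) * r ^ (σ - 1 - 1))) r :=
    fun r hr ↦ (Real.hasDerivAt_rpow_const (Or.inl (hr₁.trans hr).ne')).const_mul A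
  have hdu : ∀ r ∈ J, DifferentiableAt ℝ u r := fun r hr ↦
    (hu_ev r hr).differentiableAt_iff.mpr (hderiv r hr).differentiableAt
  have hsD : ∀ r ∈ J, -(r • deriv u r) = (A * (1 - σ)) * r ^ (σ - 1) := by
    intro r hr
    have hr0 : (r : ℝ) ≠ 0 := (hr₁.trans hr).ne'
    rw [(hu_ev r hr).deriv_eq, (hderiv r hr).deriv, smul_eq_mul, Real.rpow_sub_one hr0 (σ - 1)]
    field_simp
    ring
  have hreg : CtRegularOn J (fun r (_ : sphere (0 : E3) 1) ↦ u r) :=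
    ⟨fun r _ p ↦ sphereDiffAt_const 2 (u r) p, fun r hr _ ↦ hdu r hr⟩
  have hA1 : angPart 1 (fun r (_ : sphere (0 : E3) 1) ↦ u r) = fun _ _ ↦ 0 := angPart_succ_pconst 0 u
  have hA2 : angPart 2 (fun r (_ : sphere (0 : E3) 1) ↦ u r) = fun _ _ ↦ 0 := angPart_succ_pconst 1 u
  have hS : sDeriv (fun r (_ : sphere (0 : E3) 1) ↦ u r) = fun r _ ↦ -(r • deriv u r) := rfl
  have z1 : tailSupNorm J (fun (_ : ℝ) (_ : sphere (0 : E3) 1) ↦ (0 : E3 [×1]→L[ℝ] ℝ)) = 0 :=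
    tailSupNorm_of_vanish fun _ _ ↦ rfl
  have z2 : tailSupNorm J (fun (_ : ℝ) (_ : sphere (0 : E3) 1) ↦ (0 : E3 [×2]→L[ℝ] ℝ)) = 0 :=
    tailSupNorm_of_vanish fun _ _ ↦ rfl
  have z3 : tailHolderSeminorm α J (fun (_ : ℝ) (_ : sphere (0 : E3) 1) ↦ (0 : E3 [×2]→L[ℝ] ℝ)) = 0 :=
    tailHolderSeminorm_of_vanish α fun _ _ ↦ rfl
  have hθ : σ - 1 ≤ 0 := by linarith
  have b1 : tailSupNorm J (fun r (_ : sphere (0 : E3) 1) ↦ u r) ≤ ENNReal.ofReal (|A| * r₁ ^ (σ - 1)) :=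
    tailSupNorm_pconst_le fun r hr ↦ by rw [hu r hr]; exact norm_rpow_profile_le hr₁ hθ hr
  have b2 : tailSupNorm J (fun r (_ : sphere (0 : E3) 1) ↦ -(r • deriv u r)) ≤
      ENNReal.ofReal (|A * (1 - σ)| * r₁ ^ (σ - 1)) :=
    tailSupNorm_pconst_le fun r hr ↦ by rw [hsD r hr]; exact norm_rpow_profile_le hr₁ hθ hr
  have b3 : tailHolderSeminorm α J (fun r (_ : sphere (0 : E3) 1) ↦ -(r • deriv u r)) ≤
      ENNReal.ofReal (max (|A * (1 - σ)| * |σ - 1| * r₁ ^ (σ - 1)) (2 * (|A * (1 - σ)| * r₁ ^ (σ - 1)))) :=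
    tailHolderSeminorm_pconst_le hJ hα hα2 (by positivity) (by positivity)
      (fun r hr ↦ by rw [hsD r hr]; exact norm_rpow_profile_le hr₁ hθ hr)
      (fun r hr r' hr' ↦ by rw [hsD r hr, hsD r' hr']; exact rpow_profile_lip hr₁ hθ hr hr')
  rw [ctWeightedNorm, hW]
  simp only [ctNorm, hreg, if_true, hA1, hA2, hS, z1, z2, z3, add_zero]
  refine lt_of_le_of_lt (add_le_add (add_le_add b1 b2) b3) ?_
  exact ENNReal.add_lt_top.mpr ⟨ENNReal.add_lt_top.mpr ⟨ENNReal.ofReal_lt_top, ENNReal.ofReal_lt_top⟩,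
    ENNReal.ofReal_lt_top⟩

/-- Exponent bookkeeping for the weighted radial derivatives of `A/r`. [folklore] -/
private theorem rpow_mul_zpow_profile {r : ℝ} (hr : 0 < r) (σ : ℝ) (ℓ : ℕ) :
    r ^ (σ + (ℓ : ℝ)) * r ^ (-1 - ℓ : ℤ) = r ^ (σ - 1) := by
  rw [← Real.rpow_intCast, ← Real.rpow_add hr]
  congr 1
  push_cast
  ring

/-- `D̸⁰` of a real number as a multiple of the unit `e₁ = uncurry0 1`. [folklore] -/
private theorem uncurry0_real (x : ℝ) :
    ContinuousMultilinearMap.uncurry0 ℝ E3 x = x • ContinuousMultilinearMap.uncurry0 ℝ E3 (1 : ℝ) := by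
  ext m; simp

/-- **The strengthened weighted norm `C^{2+α,1+α/2,♯}_{-σ}` of the mass profile `A/r` on `r > r₁ > 0` is
finite for every weight `σ ≤ 1`**: all angular derivatives vanish and `r^{σ+ℓ} ∂_r^ℓ (A/r) = ± ℓ! A r^{σ-1}`.
[cite: Ellithy2026, Defs. 3.1–3.4, p. 20] -/
theorem ctSharpNorm_inv_profile_lt_top {α σ r₁ : ℝ} (hα : 0 < α) (hα2 : α ≤ 2) (hσ : σ ≤ 1) (hr₁ : 0 < r₁)
    (A : ℝ) : ctSharpWeightedNorm α σ (Ioi r₁) (fun r (_ : sphere (0 : E3) 1) ↦ A * r⁻¹) < ⊤ := by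
  set J := Ioi r₁ with hJdef
  have hJ : J ⊆ Ioi 0 := fun r hr ↦ hr₁.trans hr
  set c : ℝ → ℝ := fun r ↦ A * r⁻¹ with hcdef
  have hc_iter : ∀ n : ℕ, iteratedDeriv n c = fun r ↦ A * ((-1) ^ n * n ! * r ^ (-1 - n : ℤ)) := by
    intro n; funext r
    rw [hcdef, iteratedDeriv_const_mul_field, iteratedDeriv_eq_iterate]
    change A * (deriv^[n] Inv.inv r) = _
    rw [iter_deriv_inv]
  have hc_diff : ∀ n, ∀ r ∈ J, DifferentiableAt ℝ (iteratedDeriv n c) r := by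
    intro n r hr
    rw [hc_iter n]
    have hr0 : r ≠ 0 := (hr₁.trans hr).ne'
    exact ((differentiableAt_zpow.mpr (Or.inl hr0)).const_mul _).const_mul _
  have hreg : CtSharpRegularOn J (fun r (_ : sphere (0 : E3) 1) ↦ c r) := by
    refine ⟨fun r _ p ↦ sphereDiffAt_const 4 (c r) p, fun ℓ j _ _ _ r hr p m _ ↦ ?_⟩
    cases j with
    | zero =>
      simp only [sphereCovDeriv_zero_eq, iteratedDeriv_uncurry0_fun]
      exact differentiableAt_uncurry0_comp_iff.mpr (hc_diff m r hr)
    | succ j =>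
      simp only [sphereCovDeriv_succ_const, iteratedDeriv_zero_fun]
      exact differentiableAt_const _
  -- the unit `e₁` and the weighted radial profiles `r^{σ+ℓ} D̸⁰(∂_r^ℓ c)`
  set e₁ : E3 [×0]→L[ℝ] ℝ := ContinuousMultilinearMap.uncurry0 ℝ E3 (1 : ℝ) with he₁def
  have he₁ : ‖e₁‖ = 1 := by simp [he₁def]
  have hθ : σ - 1 ≤ 0 := by linarith
  have hU : ∀ (ℓ : ℕ), ∀ r ∈ J,
      (r ^ (σ + (ℓ : ℝ))) • ContinuousMultilinearMap.uncurry0 ℝ E3 (A * ((-1) ^ ℓ * ℓ ! * r ^ (-1 - ℓ : ℤ))) =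
        ((A * ((-1) ^ ℓ * ℓ !)) * r ^ (σ - 1)) • e₁ := by
    intro ℓ r hr
    have hr0 : (0 : ℝ) < r := hr₁.trans hr
    rw [uncurry0_real, smul_smul]
    congr 1
    rw [← rpow_mul_zpow_profile hr0 σ ℓ]
    ring
  have hsum1 : ∀ j ∈ Finset.Icc 3 4,
      tailSupNorm J (rpowWeight σ (angPart j (fun r (_ : sphere (0 : E3) 1) ↦ c r))) < ⊤ := by
    intro j hj
    obtain ⟨j', rfl⟩ : ∃ j', j = j' + 1 :=
      Nat.exists_eq_succ_of_ne_zero (by have := (Finset.mem_Icc.mp hj).1; omega)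
    rw [angPart_succ_pconst, tailSupNorm_of_vanish (rpowWeight_vanish σ fun _ _ ↦ rfl)]
    exact ENNReal.zero_lt_top
  have hsum2 : ∀ ℓ ∈ Finset.Icc 1 3, ∀ j ∈ Finset.range (4 - ℓ),
      czNorm α J (rpowWeight (σ + ℓ) (radAngPart ℓ j (fun r (_ : sphere (0 : E3) 1) ↦ c r))) < ⊤ := by
    intro ℓ _ j _
    cases j with
    | succ j' =>
      rw [radAngPart_succ_pconst, czNorm_of_vanish α (rpowWeight_vanish _ fun _ _ ↦ rfl)]
      exact ENNReal.zero_lt_top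
    | zero =>
      rw [radAngPart_zero_pconst, hc_iter ℓ]
      have hB : ∀ r ∈ J, ‖(r ^ (σ + (ℓ : ℝ))) • ContinuousMultilinearMap.uncurry0 ℝ E3
          (A * ((-1) ^ ℓ * ℓ ! * r ^ (-1 - ℓ : ℤ)))‖ ≤ |A * ((-1) ^ ℓ * ℓ !)| * r₁ ^ (σ - 1) := by
        intro r hr
        rw [hU ℓ r hr, norm_smul, he₁, mul_one]
        exact norm_rpow_profile_le hr₁ hθ hr
      have hL : ∀ r ∈ J, ∀ r' ∈ J, ‖(r ^ (σ + (ℓ : ℝ))) • ContinuousMultilinearMap.uncurry0 ℝ E3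
          (A * ((-1) ^ ℓ * ℓ ! * r ^ (-1 - ℓ : ℤ))) - (r' ^ (σ + (ℓ : ℝ))) • ContinuousMultilinearMap.uncurry0 ℝ E3
          (A * ((-1) ^ ℓ * ℓ ! * r' ^ (-1 - ℓ : ℤ)))‖ ≤
            |A * ((-1) ^ ℓ * ℓ !)| * |σ - 1| * r₁ ^ (σ - 1) * |Real.log r - Real.log r'| := by
        intro r hr r' hr'
        rw [hU ℓ r hr, hU ℓ r' hr', ← sub_smul, norm_smul, he₁, mul_one]
        exact rpow_profile_lip hr₁ hθ hr hr'
      have b1 := tailSupNorm_pconst_le (J := J) hB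
      have b2 := tailHolderSeminorm_pconst_le hJ hα hα2 (by positivity) (by positivity) hB hL
      rw [czNorm]
      exact lt_of_le_of_lt (add_le_add b1 b2) (ENNReal.add_lt_top.mpr ⟨ENNReal.ofReal_lt_top, ENNReal.ofReal_lt_top⟩)
  show ctSharpWeightedNorm α σ J (fun r (_ : sphere (0 : E3) 1) ↦ c r) < ⊤
  simp only [ctSharpWeightedNorm, hreg, if_true, ENNReal.add_lt_top]
  exact ⟨⟨ctNorm_inv_profile_lt_top hα hα2 hσ hr₁ A, ENNReal.sum_lt_top.mpr hsum1⟩,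
    ENNReal.sum_lt_top.mpr fun ℓ hℓ ↦ ENNReal.sum_lt_top.mpr (hsum2 ℓ hℓ)⟩

/-! ### Static fields: only the `j = 0` time derivative survives -/

/-- Helper (`tDeriv_static_zero`). [cite: Ellithy2026, Defs. 3.1–3.4, p. 20] -/
theorem tDeriv_static_zero (c : ℝ → sphere (0 : E3) 1 → W) (t : ℝ) :
    ADMTailTuple.tDeriv 0 (fun (_ : ℝ) r p ↦ c r p) t = c := by
  funext r p; simp [ADMTailTuple.tDeriv]

/-- Helper (`tDeriv_static_succ`). [cite: Ellithy2026, Defs. 3.1–3.4, p. 20] -/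
theorem tDeriv_static_succ (j : ℕ) (c : ℝ → sphere (0 : E3) 1 → W) (t : ℝ) :
    ADMTailTuple.tDeriv (j + 1) (fun (_ : ℝ) r p ↦ c r p) t = fun _ _ ↦ 0 := by
  funext r p; simp only [ADMTailTuple.tDeriv]; rw [iteratedDeriv_const]; simp

/-- Helper (`tDiffOn_static`). [cite: Ellithy2026, Defs. 3.1–3.4, p. 20] -/
theorem tDiffOn_static (j : ℕ) (Tlo r₁ : ℝ) (c : ℝ → sphere (0 : E3) 1 → W) :
    ADMTailTuple.TDiffOn j Tlo r₁ (fun (_ : ℝ) r p ↦ c r p) := by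
  intro t _ r _ p m _
  have : iteratedDeriv m (fun _ : ℝ ↦ c r p) = fun _ ↦ if m = 0 then c r p else 0 := by
    funext x; rw [iteratedDeriv_const]
  rw [this]; exact differentiableAt_const _

/-- Helper (`supTailNorm_static_succ`). [cite: Ellithy2026, Defs. 3.1–3.4, p. 20] -/
theorem supTailNorm_static_succ (α σ : ℝ) (j : ℕ) (Tlo r₁ : ℝ) (c : ℝ → sphere (0 : E3) 1 → W) :
    ADMTailTuple.supTailNorm α σ (j + 1) Tlo r₁ (fun (_ : ℝ) r p ↦ c r p) = 0 := by
  simp only [ADMTailTuple.supTailNorm, tDiffOn_static, if_true, tDeriv_static_succ, ENNReal.iSup_eq_zero]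
  intro t _; exact ctWeightedNorm_of_vanish isOpen_Ioi α σ fun _ _ ↦ rfl

/-- Helper (`supTailNorm_static_zero_le`). [cite: Ellithy2026, Defs. 3.1–3.4, p. 20] -/
theorem supTailNorm_static_zero_le (α σ Tlo r₁ : ℝ) (c : ℝ → sphere (0 : E3) 1 → W) :
    ADMTailTuple.supTailNorm α σ 0 Tlo r₁ (fun (_ : ℝ) r p ↦ c r p) ≤ ctWeightedNorm α σ (Ioi r₁) c := by
  simp only [ADMTailTuple.supTailNorm, tDiffOn_static, if_true, tDeriv_static_zero]
  exact iSup₂_le fun _ _ ↦ le_rfl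

/-- Helper (`supSharpTailNorm_static_succ`). [cite: Ellithy2026, Defs. 3.1–3.4, p. 20] -/
theorem supSharpTailNorm_static_succ (α σ : ℝ) (k : ℕ) (Tlo r₁ : ℝ) (c : ℝ → sphere (0 : E3) 1 → W) :
    ADMTailTuple.supSharpTailNorm α σ (k + 1) Tlo r₁ (fun (_ : ℝ) r p ↦ c r p) = 0 := by
  simp only [ADMTailTuple.supSharpTailNorm, tDiffOn_static, if_true, tDeriv_static_succ, ENNReal.iSup_eq_zero]
  intro t _; exact ctSharpWeightedNorm_of_vanish isOpen_Ioi α σ fun _ _ ↦ rfl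

/-- Helper (`supSharpTailNorm_static_zero_le`). [cite: Ellithy2026, Defs. 3.1–3.4, p. 20] -/
theorem supSharpTailNorm_static_zero_le (α σ Tlo r₁ : ℝ) (c : ℝ → sphere (0 : E3) 1 → W) :
    ADMTailTuple.supSharpTailNorm α σ 0 Tlo r₁ (fun (_ : ℝ) r p ↦ c r p) ≤
      ctSharpWeightedNorm α σ (Ioi r₁) c := by
  simp only [ADMTailTuple.supSharpTailNorm, tDiffOn_static, if_true, tDeriv_static_zero]
  exact iSup₂_le fun _ _ ↦ le_rfl

end Profile

/-! ## §11 The Schwarzschild tail `schw m` (mass `m`, first order in `m/r`) inhabits `𝒞𝒮♯_{-τ}`, `τ ≤ 1` -/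

/-- **The Schwarzschild exterior tail of mass `m` to first order**: `N = 1 - m/r`, `λ = 1 + m/r`,
`β = 0`, `b = 0`, `γ = r² γ_{S²}` (the `O(m/r)` truncation of `N = (1 - 2m/r)^{1/2}`,
`λ = (1 - 2m/r)^{-1/2}` in the areal gauge; `m` = the ADM mass read off either coefficient).
[cite: Ellithy2026, Remark 4.6, p. 40; Def. 3.6, p. 21] -/
abbrev schw (m : ℝ) : ADMTailTuple := radial (fun r ↦ 1 - m * r⁻¹) (fun r ↦ 1 + m * r⁻¹)

/-- The first-order Schwarzschild tail `schw m`: `lapseDev`. [cite: Ellithy2026, Remark 4.6, p. 40; Def. 3.6, p. 21] -/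
theorem schw_lapseDev (m : ℝ) : (schw m).lapseDev = fun _ r _ ↦ (-m) * r⁻¹ := by
  funext t r p; show (1 - m * r⁻¹) - 1 = -m * r⁻¹; ring

/-- The first-order Schwarzschild tail `schw m`: `lamDev`. [cite: Ellithy2026, Remark 4.6, p. 40; Def. 3.6, p. 21] -/
theorem schw_lamDev (m : ℝ) : (schw m).lamDev = fun _ r _ ↦ m * r⁻¹ := by
  funext t r p; show (1 + m * r⁻¹) - 1 = m * r⁻¹; ring

/-- `𝒩_τ(r₁) < ∞` for the Schwarzschild tail (`τ ≤ 1`, `0 < α ≤ 2`, `r₁ > 0`).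
[cite: Ellithy2026, Remark 4.6, p. 40; Def. 3.6, p. 21] -/
theorem schw_tailNormN_lt_top {m α τ r₁ : ℝ} (hα : 0 < α) (hα2 : α ≤ 2) (hτ : τ ≤ 1) (hr₁ : 0 < r₁)
    (Tlo : ℝ) : (schw m).tailNormN α τ Tlo r₁ < ⊤ := by
  rw [ADMTailTuple.tailNormN, schw_lapseDev, schw_lamDev, show (schw m).b = fun _ _ _ ↦ 0 from rfl,
    show (schw m).shift = fun _ _ _ ↦ 0 from radial_shift _ _, show (schw m).gammaDev = flat.gammaDev from rfl]
  refine ENNReal.sum_lt_top.mpr fun j _ ↦ ?_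
  rw [supTailNorm_of_vanish _ _ _ _ _ (flat_gammaDev_vanish hr₁.le)]
  simp only [ENNReal.add_lt_top, supTailNorm_zero_fun, add_zero]
  cases j with
  | zero =>
    simp only [Nat.cast_zero, add_zero]
    exact ⟨lt_of_le_of_lt (supTailNorm_static_zero_le _ _ _ _ _) (ctNorm_inv_profile_lt_top hα hα2 hτ hr₁ (-m)),
      lt_of_le_of_lt (supTailNorm_static_zero_le _ _ _ _ _) (ctNorm_inv_profile_lt_top hα hα2 hτ hr₁ m)⟩
  | succ j =>
    rw [supTailNorm_static_succ, supTailNorm_static_succ]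
    exact ⟨ENNReal.zero_lt_top, ENNReal.zero_lt_top⟩

/-- `𝒩♯_τ(r₁) < ∞` for the Schwarzschild tail (`τ ≤ 1`, `0 < α ≤ 2`, `r₁ > 0`).
[cite: Ellithy2026, Remark 4.6, p. 40; Def. 3.6, p. 21] -/
theorem schw_sharpTailNormN_lt_top {m α τ r₁ : ℝ} (hα : 0 < α) (hα2 : α ≤ 2) (hτ : τ ≤ 1) (hr₁ : 0 < r₁)
    (Tlo : ℝ) : (schw m).sharpTailNormN α τ Tlo r₁ < ⊤ := by
  rw [ADMTailTuple.sharpTailNormN, schw_lapseDev, schw_lamDev, show (schw m).b = fun _ _ _ ↦ 0 from rfl,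
    show (schw m).shift = fun _ _ _ ↦ 0 from radial_shift _ _, show (schw m).gammaDev = flat.gammaDev from rfl]
  refine ENNReal.sum_lt_top.mpr fun k _ ↦ ?_
  rw [supSharpTailNorm_of_vanish _ _ _ _ _ (flat_gammaDev_vanish hr₁.le)]
  simp only [ENNReal.add_lt_top, supSharpTailNorm_zero_fun, add_zero]
  cases k with
  | zero =>
    simp only [Nat.cast_zero, add_zero]
    exact ⟨lt_of_le_of_lt (supSharpTailNorm_static_zero_le _ _ _ _ _)
        (ctSharpNorm_inv_profile_lt_top hα hα2 hτ hr₁ (-m)),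
      lt_of_le_of_lt (supSharpTailNorm_static_zero_le _ _ _ _ _)
        (ctSharpNorm_inv_profile_lt_top hα hα2 hτ hr₁ m)⟩
  | succ k =>
    rw [supSharpTailNorm_static_succ, supSharpTailNorm_static_succ]
    exact ⟨ENNReal.zero_lt_top, ENNReal.zero_lt_top⟩

/-- **The Schwarzschild tail of mass `m` is in the class `𝒞𝒮_{-τ}(ℳ_{T̲, r₀})` of Definition 3.6** for
every `r₀ ≥ 2|m|`, `r₀ > 0`, every `0 < α ≤ 2`, every order `τ ≤ 1` and every `T̲`
(tail nondegeneracy constants `δ_* = ϑ_* = 1/2`, `c_* = 1/4`; forcing `Ξ ≡ 0`).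
[cite: Ellithy2026, Remark 4.6, p. 40; Def. 3.6, p. 21] -/
theorem schw_isTailCoeff {m r₀ α τ : ℝ} (hr₀ : 0 < r₀) (hm : 2 * |m| ≤ r₀) (hα : 0 < α) (hα2 : α ≤ 2)
    (hτ : τ ≤ 1) (Tlo : ℝ) : (schw m).IsTailCoeff α τ Tlo r₀ := by
  have hbd : ∀ r, r₀ < r → |m * r⁻¹| ≤ 1 / 2 := by
    intro r hr
    have hr0 : 0 < r := hr₀.trans hr
    rw [abs_mul, abs_inv, abs_of_pos hr0, ← div_eq_mul_inv, div_le_iff₀ hr0]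
    linarith
  have hdiff : ∀ r, r₀ < r → DifferentiableAt ℝ (fun r : ℝ ↦ 1 + m * r⁻¹) r := by
    intro r hr
    have hr0 : r ≠ 0 := (hr₀.trans hr).ne'
    exact ((differentiableAt_inv_iff.mpr hr0).const_mul m).const_add 1
  refine ⟨radial_isWellFormedOn _ _ hr₀.le Tlo, fun r₁ hr₁ ↦ ⟨?_, ?_, fun T ↦ ?_⟩⟩
  · exact schw_tailNormN_lt_top hα hα2 hτ (hr₀.trans hr₁) Tlo
  · refine radial_isTailNondegenerate _ _ (hr₀.le.trans hr₁.le) (δ := 1 / 2) (ϑ := 1 / 2)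
      (by norm_num) (by norm_num) ?_ ?_ Tlo
    · intro r hr
      have h := abs_le.mp (hbd r (hr₁.trans hr))
      constructor <;> norm_num <;> linarith [h.1, h.2]
    · intro r hr
      have h := abs_le.mp (hbd r (hr₁.trans hr))
      constructor <;> norm_num <;> linarith [h.1, h.2]
  · exact radial_hasFiniteForcingTail _ _ (hr₀.le.trans hr₁.le) (fun ρ hρ ↦ hdiff ρ (hr₁.trans hρ)) Tlo T

/-- **The Schwarzschild tail of mass `m` is in the strengthened class `𝒞𝒮♯_{-τ}(ℳ_{T̲, r₀})` of
Definition 3.8** (`r₀ ≥ 2|m|`, `r₀ > 0`, `0 < α ≤ 2`, `τ ≤ 1`; in particular for the Def. 4.4 window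
`α ∈ (0,1)`, `τ ∈ (1/2, 1)`). [cite: Ellithy2026, Remark 4.6, p. 40; Def. 3.6, p. 21] -/
theorem schw_isSharpTailCoeff {m r₀ α τ : ℝ} (hr₀ : 0 < r₀) (hm : 2 * |m| ≤ r₀) (hα : 0 < α) (hα2 : α ≤ 2)
    (hτ : τ ≤ 1) (Tlo : ℝ) : (schw m).IsSharpTailCoeff α τ Tlo r₀ :=
  ⟨schw_isTailCoeff hr₀ hm hα hα2 hτ Tlo, fun _ hr₁ ↦ schw_sharpTailNormN_lt_top hα hα2 hτ (hr₀.trans hr₁) Tlo⟩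

/-! ## §12 The threshold: for `τ > 1` a nonzero mass leaves the class (`𝒩_τ = ∞`) -/

/-- The `t`-supremum of a static field's `j = 0` weighted norm is that norm.
[cite: Ellithy2026, Defs. 3.1–3.4, p. 20] -/
theorem supTailNorm_static_zero_eq {W : Type*} [NormedAddCommGroup W] [NormedSpace ℝ W] (α σ Tlo r₁ : ℝ)
    (c : ℝ → sphere (0 : E3) 1 → W) :
    ADMTailTuple.supTailNorm α σ 0 Tlo r₁ (fun (_ : ℝ) r p ↦ c r p) = ctWeightedNorm α σ (Ioi r₁) c := by
  simp only [ADMTailTuple.supTailNorm, tDiffOn_static, if_true, tDeriv_static_zero]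
  exact le_antisymm (iSup₂_le fun _ _ ↦ le_rfl) (le_iSup₂_of_le (Tlo + 1) (by linarith) le_rfl)

/-- The weighted sup norm is dominated by the weighted `C^{2+α,1+α/2}` norm (in both guard branches).
[cite: Ellithy2026, Defs. 3.1–3.4, p. 20] -/
theorem tailSupNorm_le_ctWeightedNorm {W : Type*} [NormedAddCommGroup W] [NormedSpace ℝ W] (α σ : ℝ)
    (J : Set ℝ) (v : ℝ → sphere (0 : E3) 1 → W) : tailSupNorm J (rpowWeight σ v) ≤ ctWeightedNorm α σ J v := by
  rw [ctWeightedNorm, ctNorm]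
  split_ifs
  · exact le_add_right (le_add_right (le_add_right (le_add_right le_self_add)))
  · exact le_top

/-- A reference point of the unit sphere. [folklore] -/
def northPole : sphere (0 : E3) 1 := ⟨EuclideanSpace.single 0 1, by simp⟩

/-- **For `σ > 1` the weighted sup norm of a nonzero mass profile `A/r` is infinite**:
`sup_{r > r₁} r^σ |A|/r = ∞`. [cite: Ellithy2026, Defs. 3.1–3.4, p. 20] -/
theorem tailSupNorm_weighted_inv_eq_top {σ r₁ A : ℝ} (hσ : 1 < σ) (hr₁ : 0 ≤ r₁) (hA : A ≠ 0) :
    tailSupNorm (Ioi r₁) (rpowWeight σ (fun r (_ : sphere (0 : E3) 1) ↦ A * r⁻¹)) = ⊤ := by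
  have htend : Tendsto (fun r : ℝ ↦ |A| * r ^ (σ - 1)) atTop atTop :=
    (tendsto_rpow_atTop (by linarith)).const_mul_atTop (abs_pos.mpr hA)
  refine top_unique ?_
  rw [← ENNReal.iSup_natCast]
  refine iSup_le fun n ↦ ?_
  obtain ⟨R, hR⟩ := Filter.tendsto_atTop_atTop.mp htend n
  set r := max R (r₁ + 1) with hrdef
  have hrJ : r ∈ Ioi r₁ := lt_of_lt_of_le (lt_add_one r₁) (le_max_right _ _)
  have hr0 : 0 < r := lt_of_le_of_lt hr₁ hrJ
  refine le_iSup₂_of_le r hrJ (le_iSup_of_le northPole ?_)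
  rw [rpowWeight_apply, ← ofReal_norm, ← ENNReal.ofReal_natCast]
  refine ENNReal.ofReal_le_ofReal ?_
  calc (n : ℝ) ≤ |A| * r ^ (σ - 1) := hR r (le_max_left _ _)
    _ = ‖r ^ σ • (A * r⁻¹)‖ := by
      rw [smul_eq_mul, Real.norm_eq_abs, abs_mul, abs_mul, abs_inv, abs_of_pos (Real.rpow_pos_of_pos hr0 σ),
        abs_of_pos hr0, Real.rpow_sub_one hr0.ne']
      ring

/-- **Threshold theorem.**  For every order `τ > 1` and every nonzero mass `m`, the Schwarzschild tail
is NOT in the class `𝒞𝒮_{-τ}(ℳ_{T̲, r₀})`: its lapse deviation `-m/r` has `𝒩_τ(r₁) = ∞` on every tail.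
Together with `schw_isSharpTailCoeff` (`τ ≤ 1`): the decay window `τ ∈ (1/2, 1)` of Def. 4.4 is exactly
the mass-compatible one. [cite: Ellithy2026, Remark 4.6, p. 40; Def. 3.6, p. 21] -/
theorem schw_not_isTailCoeff {m α τ Tlo r₀ : ℝ} (hm : m ≠ 0) (hτ : 1 < τ) : ¬ (schw m).IsTailCoeff α τ Tlo r₀ := by
  rintro ⟨-, h⟩
  set r₁ := max r₀ 0 + 1 with hr₁def
  have hr₁ : r₀ < r₁ := by have := le_max_left r₀ 0; linarith
  have hr₁0 : 0 ≤ r₁ := by have := le_max_right r₀ 0; linarith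
  have hfin : (schw m).tailNormN α τ Tlo r₁ < ⊤ := (h r₁ hr₁).1
  have hle : ADMTailTuple.supTailNorm α (τ + ((0 : ℕ) : ℝ)) 0 Tlo r₁ (schw m).lapseDev ≤
      (schw m).tailNormN α τ Tlo r₁ := by
    rw [ADMTailTuple.tailNormN]
    refine le_trans ?_ (Finset.single_le_sum (fun _ _ ↦ zero_le) (Finset.mem_range.mpr (by norm_num : 0 < 3)))
    exact le_add_right (le_add_right (le_add_right le_self_add))
  have htop : ADMTailTuple.supTailNorm α (τ + ((0 : ℕ) : ℝ)) 0 Tlo r₁ (schw m).lapseDev = ⊤ := by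
    rw [schw_lapseDev, Nat.cast_zero, add_zero, supTailNorm_static_zero_eq]
    exact top_unique ((tailSupNorm_weighted_inv_eq_top hτ hr₁0 (neg_ne_zero.mpr hm)).symm.le.trans
      (tailSupNorm_le_ctWeightedNorm α τ _ _))
  rw [htop, top_le_iff] at hle
  exact absurd hfin (by rw [hle]; exact lt_irrefl _)

/-! ## §13 Rest frame (Ellithy §4.1): the static family has vanishing ADM momentum flux -/

section RestFrame

variable (f g : ℝ → ℝ)

/-- The static spherically symmetric family `radial f g`: `sliceTrK`. [cite: Ellithy2026, §4.1, p. 38] -/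
theorem radial_sliceTrK (t : ℝ) (y : E3) : (radial f g).sliceTrK t y = 0 := by
  simp [ADMTailTuple.sliceTrK, radial_sliceK]

/-- The static spherically symmetric family `radial f g`: `sliceMomentumFlux`. [cite: Ellithy2026, §4.1, p. 38] -/
theorem radial_sliceMomentumFlux (t : ℝ) (i : Fin 3) (R : ℝ) : (radial f g).sliceMomentumFlux t i R = 0 := by
  simp [ADMTailTuple.sliceMomentumFlux, radial_sliceK, radial_sliceTrK]

/-- The slices of the static family are adapted to the ADM rest frame (`P_i(R) ≡ 0`).
[cite: Ellithy2026, §4.1, p. 38] -/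
theorem radial_isRestFrame (Tlo : ℝ) : (radial f g).IsRestFrame Tlo := by
  intro t _ i
  rw [show (radial f g).sliceMomentumFlux t i = fun _ ↦ 0 from funext (radial_sliceMomentumFlux f g t i)]
  exact tendsto_const_nhds

/-- The flat (Minkowski) tuple: `sliceTrK`. [cite: Ellithy2026, §4.1, p. 38] -/
theorem flat_sliceTrK (t : ℝ) (y : E3) : flat.sliceTrK t y = 0 := by
  simp [ADMTailTuple.sliceTrK, flat_sliceK]

/-- The flat (Minkowski) tuple: `sliceMomentumFlux`. [cite: Ellithy2026, §4.1, p. 38] -/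
theorem flat_sliceMomentumFlux (t : ℝ) (i : Fin 3) (R : ℝ) : flat.sliceMomentumFlux t i R = 0 := by
  simp [ADMTailTuple.sliceMomentumFlux, flat_sliceK, flat_sliceTrK]

/-- The flat (Minkowski) tuple: `isRestFrame`. [cite: Ellithy2026, §4.1, p. 38] -/
theorem flat_isRestFrame (Tlo : ℝ) : flat.IsRestFrame Tlo := by
  intro t _ i
  rw [show flat.sliceMomentumFlux t i = fun _ ↦ 0 from funext (flat_sliceMomentumFlux t i)]
  exact tendsto_const_nhds

end RestFrame

/-- **Summary at the window of the quasi final state hypothesis** [cite: Ellithy2026, Def. 4.4, p. 39;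
Remark 4.6, p. 40].  For every horizon radius `r₀ > 0`, every mass `|m| ≤ r₀/2`, every Hölder exponent
`α ∈ (0,1)`, every decay order `τ ∈ (1/2, 1)` and every `T̲`, the first-order Schwarzschild tail `schw m`
satisfies the two tuple-level clauses of Def. 4.4 (1) + §4.1: `S.IsSharpTailCoeff α τ T̲ r₀ ∧ S.IsRestFrame T̲`
(the development-level clause `HasADMForm` is not addressed). -/
theorem schw_restFrameTuple {r₀ m α τ : ℝ} (hr₀ : 0 < r₀) (hm : 2 * |m| ≤ r₀) (hα : α ∈ Set.Ioo 0 1)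
    (hτ : τ ∈ Set.Ioo (1 / 2 : ℝ) 1) (Tlo : ℝ) :
    (schw m).IsSharpTailCoeff α τ Tlo r₀ ∧ (schw m).IsRestFrame Tlo :=
  ⟨schw_isSharpTailCoeff hr₀ hm hα.1 (by linarith [hα.2]) hτ.2.le Tlo, radial_isRestFrame _ _ Tlo⟩

/-! ## §14 Minkowski space inhabits the analytic quasi-final-state predicate (Def. 4.4 (1)+(2), §4.1) -/

section Minkowski

open scoped Manifold
open Filter Topology

/-- The Minkowski form `η((a, Y), (a', Y')) = -a a' + ⟪Y, Y'⟫` on the Cartesian model `ℝ × E3` (the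
ADM form of the flat tuple: `N = 1`, `β = 0`, `g(t) = δ`). [cite: Ellithy2026, §3.1 p. 21] -/
def minkForm : (ℝ × E3) →L[ℝ] (ℝ × E3) →L[ℝ] ℝ :=
  (-1 : ℝ) • (ContinuousLinearMap.mul ℝ ℝ).bilinearComp (ContinuousLinearMap.fst ℝ ℝ E3)
      (ContinuousLinearMap.fst ℝ ℝ E3)
    + innerBil.bilinearComp (ContinuousLinearMap.snd ℝ ℝ E3) (ContinuousLinearMap.snd ℝ ℝ E3)

/-- `η((a, Y), (a', Y')) = -(a a') + ⟪Y, Y'⟫`. [cite: Ellithy2026, §3.1 p. 21] -/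
@[simp] theorem minkForm_apply (v w : ℝ × E3) : minkForm v w = -(v.1 * w.1) + ⟪v.2, w.2⟫ := by
  simp [minkForm, ContinuousLinearMap.bilinearComp_apply]

/-- The late polar chart of Minkowski space `ℝ × E3`: `Φ(t, r, p) = (t, r p)`.
[cite: Ellithy2026, Def. 4.4 p. 39] -/
def minkPolarChart : ℝ × ℝ × sphere (0 : E3) 1 → ℝ × E3 := fun q ↦ (q.1, q.2.1 • (q.2.2 : E3))

/-- Off the axis the polar chart read in Cartesian slice coordinates is the identity:
`(t, y) ↦ (t, |y| · y/|y|) = (t, y)`. [cite: Ellithy2026, §3.1 p. 20] -/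
theorem polarChart_minkPolarChart_eq {q : ℝ × E3} (hq : q.2 ≠ 0) : polarChart minkPolarChart q = q := by
  obtain ⟨t, y⟩ := q
  have hy : y ≠ 0 := hq
  have hn : ‖y‖ ≠ 0 := norm_ne_zero_iff.mpr hy
  have hray : (raySphere y : E3) = ‖y‖⁻¹ • y := coe_raySphere' hy
  show (t, ‖y‖ • (raySphere y : E3)) = (t, y)
  rw [hray, smul_smul, mul_inv_cancel₀ hn, one_smul]

/-- **The chart metric of Minkowski space in its polar chart is `η`** off the axis `y = 0`.
[cite: Ellithy2026, Def. 4.4 p. 39] -/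
theorem pullbackBilin_minkPolarChart {q : ℝ × E3} (hq : q.2 ≠ 0) :
    pullbackBilin (I := 𝓘(ℝ, ℝ × E3)) (I' := 𝓘(ℝ, ℝ × E3)) (M := ℝ × E3) (polarChart minkPolarChart)
      (fun _ ↦ minkForm) q = minkForm := by
  have hopen : IsOpen {q' : ℝ × E3 | q'.2 ≠ 0} := isOpen_ne_fun continuous_snd continuous_const
  have hev : polarChart minkPolarChart =ᶠ[𝓝 q] id :=
    Filter.eventuallyEq_of_mem (hopen.mem_nhds hq) fun q' hq' ↦ polarChart_minkPolarChart_eq hq'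
  have hd : mfderiv 𝓘(ℝ, ℝ × E3) 𝓘(ℝ, ℝ × E3) (polarChart minkPolarChart) q =
      ContinuousLinearMap.id ℝ (ℝ × E3) := by
    rw [hev.mfderiv_eq, mfderiv_id]; rfl
  refine ContinuousLinearMap.ext fun v ↦ ContinuousLinearMap.ext fun w ↦ ?_
  change minkForm (mfderiv 𝓘(ℝ, ℝ × E3) 𝓘(ℝ, ℝ × E3) (polarChart minkPolarChart) q v)
      (mfderiv 𝓘(ℝ, ℝ × E3) 𝓘(ℝ, ℝ × E3) (polarChart minkPolarChart) q w) = minkForm v w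
  rw [hd]; rfl

/-- **The ADM form of the flat tuple is `η`** off the axis (`N = 1`, `β = 0`, `g(t) = δ`).
[cite: Ellithy2026, §3.1 p. 21] -/
theorem flat_admForm (t : ℝ) {y : E3} (hy : y ≠ 0) : flat.admForm t y = minkForm := by
  refine ContinuousLinearMap.ext fun v ↦ ContinuousLinearMap.ext fun w ↦ ?_
  simp [ADMTailTuple.admForm, ADMTailTuple.betaNormSq, flat_βCart, flat_gCart_eq t hy]

/-- **Minkowski space has the ADM form of the flat tuple in its polar chart** (Def. 4.4 (1), the
ADM-form clause, for the flat model), for every `r₀ ≥ 0` and `T̲`. [cite: Ellithy2026, Def. 4.4 p. 39] -/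
theorem minkowski_hasADMForm {r₀ : ℝ} (hr₀ : 0 ≤ r₀) (Tlo : ℝ) :
    HasADMForm 𝓘(ℝ, ℝ × E3) (M := ℝ × E3) (fun _ ↦ minkForm) minkPolarChart Tlo r₀ flat := by
  intro t y _ hy
  have hy0 : y ≠ 0 := by
    intro h; rw [h, norm_zero] at hy; exact absurd hy (not_lt.mpr hr₀)
  rw [pullbackBilin_minkPolarChart (q := (t, y)) hy0, flat_admForm t hy0]

/-- The normal shift of the flat tuple vanishes: `β^⊥ = β(n_t) = 0`. [cite: Ellithy2026, Def. 3.8, p. 22] -/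
theorem flat_betaPerp (t : ℝ) : flat.betaPerp t = fun _ _ ↦ 0 := by
  funext r p; simp [ADMTailTuple.betaPerp, flat_βCart]

/-- `𝔅♯(T; r₁) = 0` for the flat tuple. [cite: Ellithy2026, Def. 3.8, p. 22] -/
theorem flat_normalShiftTail (α τ Tlo r₁ T : ℝ) : flat.normalShiftTail α τ Tlo r₁ T = 0 := by
  simp only [ADMTailTuple.normalShiftTail, flat_betaPerp,
    ctSharpWeightedNorm_of_vanish isOpen_Ioi α τ (fun _ _ ↦ rfl), ENNReal.iSup_zero, ciSup_const]

/-- **The flat tuple is late-time gauge reducible** (Def. 3.29) on `ℳ_{T̲, r₀}`, `r₀ ≥ 0`.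
[cite: Ellithy2026, Def. 3.29 p. 34] -/
theorem flat_isGaugeReducible {r₀ : ℝ} (hr₀ : 0 ≤ r₀) (α τ Tlo : ℝ) : flat.IsGaugeReducible α τ Tlo r₀ := by
  refine ⟨flat_isSharpTailCoeff hr₀ α τ Tlo, fun r₁ _ ↦ ?_⟩
  simp only [ADMTailTuple.HasDecayingNormalShift, flat_normalShiftTail]
  exact tendsto_const_nhds

/-- **The flat tuple satisfies the late forcing decay (A1) ∧ (A2)** (Def. 3.28; its forcing vanishes).
[cite: Ellithy2026, Def. 3.28 p. 34] -/
theorem flat_hasLateForcingDecay {r₀ : ℝ} (hr₀ : 0 ≤ r₀) (α τ Tlo : ℝ) :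
    flat.HasLateForcingDecay α τ Tlo r₀ := by
  have hG : ∀ r₁, r₀ < r₁ → ∀ T, flat.tailG Tlo r₁ T = 0 := by
    intro r₁ hr₁ T
    have hne : ∀ σ, r₁ < σ → σ ≠ 0 := fun σ hσ ↦ ne_of_gt (lt_of_le_of_lt hr₀ (hr₁.trans hσ))
    have hae : ∀ᵐ σ ∂(volume.restrict (Ioi r₁)), flat.X0 Tlo σ T / ENNReal.ofReal σ = 0 := by
      filter_upwards [ae_restrict_mem measurableSet_Ioi] with σ hσ
      rw [flat_X0 Tlo T (hne σ hσ), ENNReal.zero_div]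
    simp only [ADMTailTuple.tailG]
    rw [lintegral_congr_ae hae, lintegral_zero]
  have hP1 : ∀ r₁, r₀ < r₁ → ∀ T, flat.tailPhi1 Tlo r₁ T = 0 := by
    intro r₁ hr₁ T
    have hne : ∀ σ, r₁ < σ → σ ≠ 0 := fun σ hσ ↦ ne_of_gt (lt_of_le_of_lt hr₀ (hr₁.trans hσ))
    have hae : ∀ᵐ σ ∂(volume.restrict (Ioi r₁)), flat.X1 Tlo σ T = 0 := by
      filter_upwards [ae_restrict_mem measurableSet_Ioi] with σ hσ
      rw [flat_X1 Tlo T (hne σ hσ)]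
    simp only [ADMTailTuple.tailPhi1]
    rw [lintegral_congr_ae hae, lintegral_zero]
  have hP2 : ∀ r₁, r₀ < r₁ → ∀ T, flat.tailPhi2 Tlo r₁ T = 0 := by
    intro r₁ hr₁ T
    have hne : ∀ σ, r₁ < σ → σ ≠ 0 := fun σ hσ ↦ ne_of_gt (lt_of_le_of_lt hr₀ (hr₁.trans hσ))
    have hae : ∀ᵐ σ ∂(volume.restrict (Ioi r₁)), flat.X2 Tlo σ T = 0 := by
      filter_upwards [ae_restrict_mem measurableSet_Ioi] with σ hσ
      rw [flat_X2 Tlo T (hne σ hσ)]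
    simp only [ADMTailTuple.tailPhi2]
    rw [lintegral_congr_ae hae, lintegral_zero]
  have hΩ : ∀ r₁, r₀ < r₁ → ∀ T, flat.tailOmega Tlo r₁ T = 0 := by
    intro r₁ hr₁ T
    simp only [ADMTailTuple.tailOmega]
    refine le_antisymm (iSup₂_le fun r hr ↦ ?_) bot_le
    rw [flat_X0 Tlo T (ne_of_gt (lt_of_le_of_lt hr₀ (hr₁.trans_le hr)))]
  refine ⟨fun r₁ hr₁ ↦ ⟨?_, ?_⟩, Or.inl fun r₁ hr₁ ↦ ⟨?_, ?_⟩⟩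
  · simp only [hG r₁ hr₁]; exact tendsto_const_nhds
  · simp only [hP1 r₁ hr₁]; exact tendsto_const_nhds
  · simp only [hP2 r₁ hr₁]; exact tendsto_const_nhds
  · simp only [hΩ r₁ hr₁]; exact tendsto_const_nhds

/-- **Non-vacuity of the typed analytic clauses of the quasi final state hypothesis**: Minkowski space
`(ℝ × E3, η)` with the polar late chart `Φ(t, r, p) = (t, r p)` satisfies
`IsQuasiFinalAnalytic` — Def. 4.4 (1) (ADM form, class `𝒞𝒮♯_{-τ}`) + (2) (gauge reducibility, forcing
decay) + §4.1 (rest frame) — for every `r₀ > 0` and `T̲` (flat model, `m = 0`; cf. Remark 4.6, p. 40,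
on the stationary exteriors; the GEOMETRIC clauses of Def. 4.4 about the horizon are not part of this
predicate). [cite: Ellithy2026, Def. 4.4 p. 39] -/
theorem minkowski_isQuasiFinalAnalytic {r₀ : ℝ} (hr₀ : 0 < r₀) (Tlo : ℝ) :
    IsQuasiFinalAnalytic 𝓘(ℝ, ℝ × E3) (M := ℝ × E3) (fun _ ↦ minkForm) minkPolarChart Tlo r₀ := by
  refine ⟨hr₀, 1 / 2, ⟨by norm_num, by norm_num⟩, 3 / 4, ⟨by norm_num, by norm_num⟩, flat,
    minkowski_hasADMForm hr₀.le Tlo, flat_isSharpTailCoeff hr₀.le _ _ Tlo,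
    flat_isGaugeReducible hr₀.le _ _ Tlo, flat_hasLateForcingDecay hr₀.le _ _ Tlo, flat_isRestFrame Tlo⟩

/-- `η` is uniformly nondegenerate w.r.t. the sup norm of `ℝ × E3`: `‖η v‖ ≥ ‖v‖`.
[cite: Ellithy2026, §3.1 p. 21] -/
theorem norm_le_norm_minkForm (v : ℝ × E3) : 1 * ‖v‖ ≤ ‖minkForm v‖ := by
  rw [one_mul, Prod.norm_def, max_le_iff]
  constructor
  · have h := (minkForm v).le_opNorm ((v.1, 0) : ℝ × E3)
    have e1 : minkForm v ((v.1, 0) : ℝ × E3) = -(v.1 * v.1) := by simp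
    have e2 : ‖((v.1, 0) : ℝ × E3)‖ = |v.1| := by
      rw [Prod.norm_mk, norm_zero, Real.norm_eq_abs, max_eq_left (abs_nonneg _)]
    rw [e1, e2, norm_neg, Real.norm_eq_abs, abs_mul] at h
    by_cases h0 : v.1 = 0
    · rw [Real.norm_eq_abs, h0, abs_zero]; exact norm_nonneg _
    · rw [Real.norm_eq_abs]
      exact le_of_mul_le_mul_right h (abs_pos.mpr h0)
  · have h := (minkForm v).le_opNorm ((0, v.2) : ℝ × E3)
    have e1 : minkForm v ((0, v.2) : ℝ × E3) = ‖v.2‖ ^ 2 := by simp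
    have e2 : ‖((0, v.2) : ℝ × E3)‖ = ‖v.2‖ := by
      rw [Prod.norm_mk, norm_zero, max_eq_right (norm_nonneg _)]
    rw [e1, e2, Real.norm_eq_abs, abs_of_nonneg (sq_nonneg _), sq] at h
    by_cases h0 : ‖v.2‖ = 0
    · rw [h0]; exact norm_nonneg _
    · exact le_of_mul_le_mul_right h (lt_of_le_of_ne (norm_nonneg _) (Ne.symm h0))

/-- **Minkowski space has uniform `C²` control on every collar** in its polar chart (the collar
sentence of Def. 4.4 (1) as typed in `QuasiFinalCollarControl`; `G ≡ η`, `C = ‖η‖`, `c = 1`), for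
every `r₀ > 0` and `T̲`. [cite: Ellithy2026, Def. 4.4 p. 39] -/
theorem minkowski_hasUniformCollarControl {r₀ : ℝ} (hr₀ : 0 < r₀) (Tlo : ℝ) :
    HasUniformCollarControl 𝓘(ℝ, ℝ × E3) (M := ℝ × E3) (fun _ ↦ minkForm) minkPolarChart Tlo r₀ := by
  intro r₁ _
  refine ⟨Tlo, r₀ / 2, ‖minkForm‖, 1, le_rfl, by positivity, one_pos, fun _ ↦ minkForm,
    contDiffOn_const, fun q hq ↦ ?_, fun q _ k _ ↦ ?_, fun q _ v ↦ norm_le_norm_minkForm v⟩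
  · have hq2 : q.2 ≠ 0 := by
      intro h; have := hq.2.1; rw [h, norm_zero] at this; linarith
    exact (pullbackBilin_minkPolarChart hq2).symm
  · rcases Nat.eq_zero_or_pos k with rfl | hk0
    · rw [norm_iteratedFDeriv_zero]
    · rw [iteratedFDeriv_const_of_ne (Nat.pos_iff_ne_zero.mp hk0)]
      simp only [Pi.zero_apply, norm_zero]; positivity

/-- Hence Minkowski space inhabits the assembled predicate `IsQuasiFinalAnalyticCollar` (Def. 4.4
(1)+(2) and §4.1 with the collar sentence), `r₀ > 0`. [cite: Ellithy2026, Def. 4.4 p. 39] -/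
theorem minkowski_isQuasiFinalAnalyticCollar {r₀ : ℝ} (hr₀ : 0 < r₀) (Tlo : ℝ) :
    IsQuasiFinalAnalyticCollar 𝓘(ℝ, ℝ × E3) (M := ℝ × E3) (fun _ ↦ minkForm) minkPolarChart Tlo r₀ :=
  ⟨minkowski_isQuasiFinalAnalytic hr₀ Tlo, minkowski_hasUniformCollarControl hr₀ Tlo⟩

end Minkowski

/-! ## §15 Generic static radial profiles: finite tail norms from weighted derivative bounds

The first-order Schwarzschild profiles `∓ m/r` of §10–§11 are an instance of a general statement: an
angle-independent static profile `u(r)` whose weighted derivatives `r^{σ+ℓ} u^{(ℓ)}(r)` are bounded on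
the tail `r > r₁ > 0` for `ℓ ≤ 2` (resp. `ℓ ≤ 4`) has finite `C^{2+α,1+α/2}_{-σ}` (resp.
`C^{2+α,1+α/2,♯}_{-σ}`) norm there (`0 < α ≤ 2`): all angular derivatives vanish, and the parabolic
Hölder quotients of each displayed radial term are controlled by the NEXT weighted derivative through the
mean value theorem in `s = log r` (`norm_sub_le_mul_abs_log_sub`).  Consequently the static spherically
symmetric tuple `radial f g` lies in `𝒞𝒮♯_{-τ}` as soon as `f - 1`, `g - 1` have bounded weighted
derivatives to order `4` and `f`, `g` are pinched between positive constants
(`radial_isSharpTailCoeff_of_profile`) — the generic form of `schw_isSharpTailCoeff`. -/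

section GenericProfile

variable {W : Type*} [NormedAddCommGroup W] [NormedSpace ℝ W]

/-- Derivative of a weighted profile `r ↦ r^θ • v(r)` at `r > 0`. [folklore] -/
private theorem hasDerivAt_rpow_smul {v : ℝ → W} {v' : W} {θ r : ℝ} (hr : 0 < r)
    (hv : HasDerivAt v v' r) :
    HasDerivAt (fun ρ ↦ ρ ^ θ • v ρ) (r ^ θ • v' + (θ * r ^ (θ - 1)) • v r) r :=
  (Real.hasDerivAt_rpow_const (p := θ) (Or.inl hr.ne')).smul hv

/-- `r · d/dr (r^θ • v) = r^{θ+1} • v' + θ • (r^θ • v)` at `r > 0`. [folklore] -/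
private theorem smul_deriv_rpow_smul {v : ℝ → W} {v' : W} {θ r : ℝ} (hr : 0 < r)
    (hv : HasDerivAt v v' r) :
    r • deriv (fun ρ ↦ ρ ^ θ • v ρ) r = r ^ (θ + 1) • v' + θ • (r ^ θ • v r) := by
  rw [(hasDerivAt_rpow_smul hr hv).deriv, smul_add, smul_smul, smul_smul, smul_smul]
  have h1 : r * r ^ θ = r ^ (θ + 1) := by rw [Real.rpow_add hr, Real.rpow_one, mul_comm]
  have h2 : r * (θ * r ^ (θ - 1)) = θ * r ^ θ := by
    have : r ^ (θ - 1) * r = r ^ θ := by rw [Real.rpow_sub_one hr.ne', div_mul_cancel₀ _ hr.ne']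
    calc r * (θ * r ^ (θ - 1)) = θ * (r ^ (θ - 1) * r) := by ring
      _ = θ * r ^ θ := by rw [this]
  rw [h1, h2]

/-- **Logarithmic Lipschitz bound for a weighted profile**: if `‖r^θ v‖ ≤ B` and `‖r^{θ+1} v'‖ ≤ B'` on
`r > r₁ > 0`, then `‖r^θ v(r) - r'^θ v(r')‖ ≤ (|θ| B + B') |log r - log r'|` (mean value theorem in
`s = log r`). [cite: Ellithy2026, Defs. 3.1–3.4, p. 20] -/
theorem norm_rpow_smul_sub_le {v dv : ℝ → W} {θ r₁ B B' : ℝ} (hr₁ : 0 < r₁)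
    (hv : ∀ r, r₁ < r → HasDerivAt v (dv r) r)
    (hB : ∀ r, r₁ < r → ‖r ^ θ • v r‖ ≤ B) (hB' : ∀ r, r₁ < r → ‖r ^ (θ + 1) • dv r‖ ≤ B')
    {r r' : ℝ} (hr : r₁ < r) (hr' : r₁ < r') :
    ‖r ^ θ • v r - r' ^ θ • v r'‖ ≤ (|θ| * B + B') * |Real.log r - Real.log r'| := by
  have hJ : Ioi r₁ ⊆ Ioi 0 := Ioi_subset_Ioi hr₁.le
  refine norm_sub_le_mul_abs_log_sub (g := fun ρ ↦ ρ ^ θ • v ρ) hJ ordConnected_Ioi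
    (fun ρ hρ ↦ (hasDerivAt_rpow_smul (hr₁.trans hρ) (hv ρ hρ)).differentiableAt) (fun ρ hρ ↦ ?_) hr hr'
  rw [smul_deriv_rpow_smul (hr₁.trans hρ) (hv ρ hρ)]
  calc ‖ρ ^ (θ + 1) • dv ρ + θ • (ρ ^ θ • v ρ)‖ ≤ ‖ρ ^ (θ + 1) • dv ρ‖ + ‖θ • (ρ ^ θ • v ρ)‖ :=
        norm_add_le _ _
    _ = ‖ρ ^ (θ + 1) • dv ρ‖ + |θ| * ‖ρ ^ θ • v ρ‖ := by rw [norm_smul θ, Real.norm_eq_abs]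
    _ ≤ B' + |θ| * B := add_le_add (hB' ρ hρ) (mul_le_mul_of_nonneg_left (hB ρ hρ) (abs_nonneg θ))
    _ = |θ| * B + B' := add_comm _ _

/-- **Generic profile lemma, `C^{2+α,1+α/2}_{-σ}` level.**  Let `u` be an angle-independent static profile
on the tail `r > r₁ > 0` with `u` and `∂_r u` differentiable there and weighted bounds
`‖r^{σ+ℓ} ∂_r^ℓ u(r)‖ ≤ B` for `ℓ ≤ 2`.  Then `‖u‖_{C^{2+α,1+α/2}_{-σ}(M_{r₁,∞})} < ∞` for every
`0 < α ≤ 2` (the angular terms vanish; `(r^σ u)_s = -(r^{σ+1} ∂_r u + σ r^σ u)` is bounded and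
log-Lipschitz). [cite: Ellithy2026, Defs. 3.1–3.4, p. 20] -/
theorem ctNorm_profile_lt_top {α σ r₁ : ℝ} (hα : 0 < α) (hα2 : α ≤ 2) (hr₁ : 0 < r₁) {u : ℝ → W}
    {B : ℝ} (hd : ∀ m ≤ 1, ∀ r, r₁ < r → DifferentiableAt ℝ (iteratedDeriv m u) r)
    (hB : ∀ ℓ ≤ 2, ∀ r, r₁ < r → ‖r ^ (σ + (ℓ : ℕ)) • iteratedDeriv ℓ u r‖ ≤ B) :
    ctWeightedNorm α σ (Ioi r₁) (fun r (_ : sphere (0 : E3) 1) ↦ u r) < ⊤ := by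
  set J := Ioi r₁ with hJdef
  have hJ : J ⊆ Ioi 0 := fun r hr ↦ hr₁.trans hr
  -- derivatives and bounds in `deriv` form
  have hu0 : ∀ r, r₁ < r → HasDerivAt u (deriv u r) r := fun r hr ↦ by
    have h := hd 0 (by norm_num) r hr
    rw [iteratedDeriv_zero] at h
    exact h.hasDerivAt
  have hu1 : ∀ r, r₁ < r → HasDerivAt (deriv u) (deriv (deriv u) r) r := fun r hr ↦ by
    have h := hd 1 le_rfl r hr
    rw [iteratedDeriv_one] at h
    exact h.hasDerivAt
  have hB0 : ∀ r, r₁ < r → ‖r ^ σ • u r‖ ≤ B := fun r hr ↦ by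
    simpa [iteratedDeriv_zero] using hB 0 (by norm_num) r hr
  have hB1 : ∀ r, r₁ < r → ‖r ^ (σ + 1) • deriv u r‖ ≤ B := fun r hr ↦ by
    simpa [iteratedDeriv_one] using hB 1 (by norm_num) r hr
  have hB2 : ∀ r, r₁ < r → ‖r ^ (σ + 1 + 1) • deriv (deriv u) r‖ ≤ B := fun r hr ↦ by
    have h := hB 2 le_rfl r hr
    rw [show iteratedDeriv 2 u = deriv (deriv u) by
      rw [iteratedDeriv_succ, iteratedDeriv_one]] at h
    have h' : σ + ((2 : ℕ) : ℝ) = σ + 1 + 1 := by push_cast; ring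
    rwa [h'] at h
  have hBnn : 0 ≤ B := (norm_nonneg _).trans (hB0 (r₁ + 1) (by linarith))
  -- the weighted profile and its `s`-derivative
  set U : ℝ → W := fun r ↦ r ^ σ • u r with hUdef
  have hW : rpowWeight σ (fun r (_ : sphere (0 : E3) 1) ↦ u r) = fun r _ ↦ U r := rfl
  have hdU : ∀ r ∈ J, DifferentiableAt ℝ U r := fun r hr ↦
    (hasDerivAt_rpow_smul (hJ hr) (hu0 r hr)).differentiableAt
  have hV : ∀ r ∈ J, -(r • deriv U r) = -(r ^ (σ + 1) • deriv u r + σ • U r) := fun r hr ↦ by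
    rw [hUdef, smul_deriv_rpow_smul (hJ hr) (hu0 r hr)]
  have hreg : CtRegularOn J (fun r (_ : sphere (0 : E3) 1) ↦ U r) :=
    ⟨fun r _ p ↦ sphereDiffAt_const 2 (U r) p, fun r hr _ ↦ hdU r hr⟩
  have hA1 : angPart 1 (fun r (_ : sphere (0 : E3) 1) ↦ U r) = fun _ _ ↦ 0 := angPart_succ_pconst 0 U
  have hA2 : angPart 2 (fun r (_ : sphere (0 : E3) 1) ↦ U r) = fun _ _ ↦ 0 := angPart_succ_pconst 1 U
  have hS : sDeriv (fun r (_ : sphere (0 : E3) 1) ↦ U r) = fun r _ ↦ -(r • deriv U r) := rfl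
  have z1 : tailSupNorm J (fun (_ : ℝ) (_ : sphere (0 : E3) 1) ↦ (0 : E3 [×1]→L[ℝ] W)) = 0 :=
    tailSupNorm_of_vanish fun _ _ ↦ rfl
  have z2 : tailSupNorm J (fun (_ : ℝ) (_ : sphere (0 : E3) 1) ↦ (0 : E3 [×2]→L[ℝ] W)) = 0 :=
    tailSupNorm_of_vanish fun _ _ ↦ rfl
  have z3 : tailHolderSeminorm α J (fun (_ : ℝ) (_ : sphere (0 : E3) 1) ↦ (0 : E3 [×2]→L[ℝ] W)) = 0 :=
    tailHolderSeminorm_of_vanish α fun _ _ ↦ rfl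
  -- bounds
  have hVb : ∀ r ∈ J, ‖-(r • deriv U r)‖ ≤ B + |σ| * B := fun r hr ↦ by
    rw [hV r hr, norm_neg]
    calc ‖r ^ (σ + 1) • deriv u r + σ • U r‖ ≤ ‖r ^ (σ + 1) • deriv u r‖ + ‖σ • U r‖ := norm_add_le _ _
      _ ≤ B + |σ| * B := by
          rw [norm_smul σ, Real.norm_eq_abs]
          exact add_le_add (hB1 r hr) (mul_le_mul_of_nonneg_left (hB0 r hr) (abs_nonneg σ))
  have hVl : ∀ r ∈ J, ∀ r' ∈ J, ‖-(r • deriv U r) - -(r' • deriv U r')‖ ≤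
      ((|σ + 1| * B + B) + |σ| * (|σ| * B + B)) * |Real.log r - Real.log r'| := fun r hr r' hr' ↦ by
    rw [hV r hr, hV r' hr', neg_sub_neg]
    have e1 : ‖r' ^ (σ + 1) • deriv u r' - r ^ (σ + 1) • deriv u r‖ ≤
        (|σ + 1| * B + B) * |Real.log r' - Real.log r| :=
      norm_rpow_smul_sub_le hr₁ hu1 hB1 hB2 hr' hr
    have e0 : ‖U r' - U r‖ ≤ (|σ| * B + B) * |Real.log r' - Real.log r| :=
      norm_rpow_smul_sub_le hr₁ hu0 hB0 hB1 hr' hr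
    calc ‖r' ^ (σ + 1) • deriv u r' + σ • U r' - (r ^ (σ + 1) • deriv u r + σ • U r)‖
        = ‖(r' ^ (σ + 1) • deriv u r' - r ^ (σ + 1) • deriv u r) + σ • (U r' - U r)‖ := by
          rw [smul_sub]; congr 1; abel
      _ ≤ ‖r' ^ (σ + 1) • deriv u r' - r ^ (σ + 1) • deriv u r‖ + ‖σ • (U r' - U r)‖ := norm_add_le _ _
      _ = ‖r' ^ (σ + 1) • deriv u r' - r ^ (σ + 1) • deriv u r‖ + |σ| * ‖U r' - U r‖ := by
          rw [norm_smul σ, Real.norm_eq_abs]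
      _ ≤ (|σ + 1| * B + B) * |Real.log r' - Real.log r| + |σ| * ((|σ| * B + B) * |Real.log r' - Real.log r|) :=
          add_le_add e1 (mul_le_mul_of_nonneg_left e0 (abs_nonneg σ))
      _ = ((|σ + 1| * B + B) + |σ| * (|σ| * B + B)) * |Real.log r - Real.log r'| := by
          rw [abs_sub_comm]; ring
  have b1 : tailSupNorm J (fun r (_ : sphere (0 : E3) 1) ↦ U r) ≤ ENNReal.ofReal B :=
    tailSupNorm_pconst_le fun r hr ↦ hB0 r hr
  have b2 : tailSupNorm J (fun r (_ : sphere (0 : E3) 1) ↦ -(r • deriv U r)) ≤ ENNReal.ofReal (B + |σ| * B) :=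
    tailSupNorm_pconst_le hVb
  have b3 : tailHolderSeminorm α J (fun r (_ : sphere (0 : E3) 1) ↦ -(r • deriv U r)) ≤
      ENNReal.ofReal (max ((|σ + 1| * B + B) + |σ| * (|σ| * B + B)) (2 * (B + |σ| * B))) :=
    tailHolderSeminorm_pconst_le hJ hα hα2 (by positivity) (by positivity) hVb hVl
  rw [ctWeightedNorm, hW]
  simp only [ctNorm, hreg, if_true, hA1, hA2, hS, z1, z2, z3, add_zero]
  refine lt_of_le_of_lt (add_le_add (add_le_add b1 b2) b3) ?_
  exact ENNReal.add_lt_top.mpr ⟨ENNReal.add_lt_top.mpr ⟨ENNReal.ofReal_lt_top, ENNReal.ofReal_lt_top⟩,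
    ENNReal.ofReal_lt_top⟩

/-- `uncurry0` commutes with scalars. [folklore] -/
private theorem uncurry0_smul (c : ℝ) (x : W) :
    ContinuousMultilinearMap.uncurry0 ℝ E3 (c • x) = c • ContinuousMultilinearMap.uncurry0 ℝ E3 x := by
  rw [← unc0_apply, ← unc0_apply, map_smul]

/-- `uncurry0` commutes with differences. [folklore] -/
private theorem uncurry0_sub (x y : W) :
    ContinuousMultilinearMap.uncurry0 ℝ E3 (x - y) =
      ContinuousMultilinearMap.uncurry0 ℝ E3 x - ContinuousMultilinearMap.uncurry0 ℝ E3 y := by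
  rw [← unc0_apply, ← unc0_apply, ← unc0_apply, map_sub]

/-- **Generic profile lemma, `C^{2+α,1+α/2,♯}_{-σ}` level.**  Let `u` be an angle-independent static
profile on the tail `r > r₁ > 0` with `∂_r^m u`, `m ≤ 3`, differentiable there and weighted bounds
`‖r^{σ+ℓ} ∂_r^ℓ u(r)‖ ≤ B` for `ℓ ≤ 4`.  Then `‖u‖_{C^{2+α,1+α/2,♯}_{-σ}(M_{r₁,∞})} < ∞` for every
`0 < α ≤ 2`: the extra tangential terms `r^σ D̸^j u`, `j = 3, 4`, and the mixed terms with `j ≥ 1` vanish,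
and each `r^{σ+ℓ} ∂_r^ℓ u`, `1 ≤ ℓ ≤ 3`, is bounded and log-Lipschitz with constant `|σ+ℓ| B + B`.
[cite: Ellithy2026, Defs. 3.1–3.4, p. 20] -/
theorem ctSharpNorm_profile_lt_top {α σ r₁ : ℝ} (hα : 0 < α) (hα2 : α ≤ 2) (hr₁ : 0 < r₁) {u : ℝ → W}
    {B : ℝ} (hd : ∀ m ≤ 3, ∀ r, r₁ < r → DifferentiableAt ℝ (iteratedDeriv m u) r)
    (hB : ∀ ℓ ≤ 4, ∀ r, r₁ < r → ‖r ^ (σ + (ℓ : ℕ)) • iteratedDeriv ℓ u r‖ ≤ B) :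
    ctSharpWeightedNorm α σ (Ioi r₁) (fun r (_ : sphere (0 : E3) 1) ↦ u r) < ⊤ := by
  set J := Ioi r₁ with hJdef
  have hJ : J ⊆ Ioi 0 := fun r hr ↦ hr₁.trans hr
  have hBnn : 0 ≤ B := (norm_nonneg _).trans (hB 0 (by norm_num) (r₁ + 1) (by linarith))
  have hreg : CtSharpRegularOn J (fun r (_ : sphere (0 : E3) 1) ↦ u r) := by
    refine ⟨fun r _ p ↦ sphereDiffAt_const 4 (u r) p, fun ℓ j _ hℓ _ r hr p m hm ↦ ?_⟩
    cases j with
    | zero =>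
      simp only [sphereCovDeriv_zero_eq, iteratedDeriv_uncurry0_fun]
      exact differentiableAt_uncurry0_comp_iff.mpr (hd m (by omega) r hr)
    | succ j =>
      simp only [sphereCovDeriv_succ_const, iteratedDeriv_zero_fun]
      exact differentiableAt_const _
  have hsum1 : ∀ j ∈ Finset.Icc 3 4,
      tailSupNorm J (rpowWeight σ (angPart j (fun r (_ : sphere (0 : E3) 1) ↦ u r))) < ⊤ := by
    intro j hj
    obtain ⟨j', rfl⟩ : ∃ j', j = j' + 1 :=
      Nat.exists_eq_succ_of_ne_zero (by have := (Finset.mem_Icc.mp hj).1; omega)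
    rw [angPart_succ_pconst, tailSupNorm_of_vanish (rpowWeight_vanish σ fun _ _ ↦ rfl)]
    exact ENNReal.zero_lt_top
  have hsum2 : ∀ ℓ ∈ Finset.Icc 1 3, ∀ j ∈ Finset.range (4 - ℓ),
      czNorm α J (rpowWeight (σ + ℓ) (radAngPart ℓ j (fun r (_ : sphere (0 : E3) 1) ↦ u r))) < ⊤ := by
    intro ℓ hℓ j _
    have hℓ3 : ℓ ≤ 3 := (Finset.mem_Icc.mp hℓ).2
    cases j with
    | succ j' =>
      rw [radAngPart_succ_pconst, czNorm_of_vanish α (rpowWeight_vanish _ fun _ _ ↦ rfl)]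
      exact ENNReal.zero_lt_top
    | zero =>
      rw [radAngPart_zero_pconst]
      -- the weighted radial term `Φ r = r^{σ+ℓ} • ∂_r^ℓ u(r)`, bounded by `B` and log-Lipschitz
      have hv : ∀ r, r₁ < r → HasDerivAt (iteratedDeriv ℓ u) (iteratedDeriv (ℓ + 1) u r) r := by
        intro r hr
        rw [iteratedDeriv_succ]
        exact (hd ℓ hℓ3 r hr).hasDerivAt
      have hBℓ : ∀ r, r₁ < r → ‖r ^ (σ + (ℓ : ℕ)) • iteratedDeriv ℓ u r‖ ≤ B :=
        fun r hr ↦ hB ℓ (by omega) r hr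
      have hBℓ' : ∀ r, r₁ < r → ‖r ^ (σ + (ℓ : ℕ) + 1) • iteratedDeriv (ℓ + 1) u r‖ ≤ B := by
        intro r hr
        have h := hB (ℓ + 1) (by omega) r hr
        have e : σ + ((ℓ + 1 : ℕ) : ℝ) = σ + (ℓ : ℕ) + 1 := by push_cast; ring
        rwa [e] at h
      have hΦb : ∀ r ∈ J, ‖(r ^ (σ + (ℓ : ℕ))) • ContinuousMultilinearMap.uncurry0 ℝ E3
          (iteratedDeriv ℓ u r)‖ ≤ B := by
        intro r hr
        rw [← uncurry0_smul, ContinuousMultilinearMap.uncurry0_norm]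
        exact hBℓ r hr
      have hΦl : ∀ r ∈ J, ∀ r' ∈ J, ‖(r ^ (σ + (ℓ : ℕ))) • ContinuousMultilinearMap.uncurry0 ℝ E3
          (iteratedDeriv ℓ u r) - (r' ^ (σ + (ℓ : ℕ))) • ContinuousMultilinearMap.uncurry0 ℝ E3
          (iteratedDeriv ℓ u r')‖ ≤ (|σ + (ℓ : ℕ)| * B + B) * |Real.log r - Real.log r'| := by
        intro r hr r' hr'
        rw [← uncurry0_smul, ← uncurry0_smul, ← uncurry0_sub, ContinuousMultilinearMap.uncurry0_norm]
        exact norm_rpow_smul_sub_le hr₁ hv hBℓ hBℓ' hr hr'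
      have b1 := tailSupNorm_pconst_le (J := J) hΦb
      have b2 := tailHolderSeminorm_pconst_le hJ hα hα2 hBnn (by positivity) hΦb hΦl
      rw [czNorm]
      exact lt_of_le_of_lt (add_le_add b1 b2)
        (ENNReal.add_lt_top.mpr ⟨ENNReal.ofReal_lt_top, ENNReal.ofReal_lt_top⟩)
  have hbase : ctWeightedNorm α σ J (fun r (_ : sphere (0 : E3) 1) ↦ u r) < ⊤ :=
    ctNorm_profile_lt_top hα hα2 hr₁ (fun m hm r hr ↦ hd m (by omega) r hr)
      (fun ℓ hℓ r hr ↦ hB ℓ (by omega) r hr)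
  show ctSharpWeightedNorm α σ J (fun r (_ : sphere (0 : E3) 1) ↦ u r) < ⊤
  simp only [ctSharpWeightedNorm, hreg, if_true, ENNReal.add_lt_top]
  exact ⟨⟨hbase, ENNReal.sum_lt_top.mpr hsum1⟩,
    ENNReal.sum_lt_top.mpr fun ℓ hℓ ↦ ENNReal.sum_lt_top.mpr (hsum2 ℓ hℓ)⟩

/-- **The static spherically symmetric tuple `radial f g` lies in the strengthened class
`𝒞𝒮♯_{-τ}(ℳ_{T̲,r₀})`** (Defs. 3.6/3.8) as soon as, on the tail `r > r₀ > 0`: `f`, `g` are pinched between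
positive constants (`ϑ ≤ f ≤ ϑ⁻¹`, `δ ≤ g ≤ δ⁻¹`: tail nondegeneracy with `r H = 2/λ`), and the deviations
`f - 1`, `g - 1` have differentiable radial derivatives to order `3` with weighted bounds
`|r^{τ+ℓ} ∂_r^ℓ (f - 1)|, |r^{τ+ℓ} ∂_r^ℓ (g - 1)| ≤ B` for `ℓ ≤ 4`; any `0 < α ≤ 2`, any `T̲`.  The forcing
vanishes (`K_t ≡ 0`).  The first-order Schwarzschild tail `schw m` (§11) is the instance
`f, g = 1 ∓ m/r`. [cite: Ellithy2026, Def. 3.8, p. 22; Remark 4.6, p. 40] -/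
theorem radial_isSharpTailCoeff_of_profile {f g : ℝ → ℝ} {r₀ α τ δ ϑ B : ℝ} (hr₀ : 0 < r₀)
    (hα : 0 < α) (hα2 : α ≤ 2) (hδ : 0 < δ) (hϑ : 0 < ϑ)
    (hg : ∀ r, r₀ < r → δ ≤ g r ∧ g r ≤ δ⁻¹) (hf : ∀ r, r₀ < r → ϑ ≤ f r ∧ f r ≤ ϑ⁻¹)
    (hdf : ∀ m ≤ 3, ∀ r, r₀ < r → DifferentiableAt ℝ (iteratedDeriv m (fun ρ ↦ f ρ - 1)) r)
    (hdg : ∀ m ≤ 3, ∀ r, r₀ < r → DifferentiableAt ℝ (iteratedDeriv m (fun ρ ↦ g ρ - 1)) r)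
    (hBf : ∀ ℓ ≤ 4, ∀ r, r₀ < r → ‖r ^ (τ + (ℓ : ℕ)) • iteratedDeriv ℓ (fun ρ ↦ f ρ - 1) r‖ ≤ B)
    (hBg : ∀ ℓ ≤ 4, ∀ r, r₀ < r → ‖r ^ (τ + (ℓ : ℕ)) • iteratedDeriv ℓ (fun ρ ↦ g ρ - 1) r‖ ≤ B)
    (Tlo : ℝ) : (radial f g).IsSharpTailCoeff α τ Tlo r₀ := by
  -- `g` itself is differentiable on the tail (needed for the forcing quantities)
  have hgd : ∀ ρ, r₀ < ρ → DifferentiableAt ℝ g ρ := by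
    intro ρ hρ
    have h := hdg 0 (by norm_num) ρ hρ
    rw [iteratedDeriv_zero] at h
    have h' := h.add_const 1
    simp only [sub_add_cancel] at h'
    exact h'
  -- finiteness of `𝒩_τ(r₁)` and `𝒩♯_τ(r₁)` on every tail `r₁ > r₀`
  have hN : ∀ r₁, r₀ < r₁ → (radial f g).tailNormN α τ Tlo r₁ < ⊤ := by
    intro r₁ hr₁
    have hr₁0 : 0 < r₁ := hr₀.trans hr₁
    rw [ADMTailTuple.tailNormN, radial_lapseDev, radial_lamDev, radial_b_fun, radial_shift,
      show (radial f g).gammaDev = flat.gammaDev from rfl]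
    refine ENNReal.sum_lt_top.mpr fun j _ ↦ ?_
    rw [supTailNorm_of_vanish _ _ _ _ _ (flat_gammaDev_vanish hr₁0.le)]
    simp only [ENNReal.add_lt_top, supTailNorm_zero_fun, add_zero]
    cases j with
    | zero =>
      simp only [Nat.cast_zero, add_zero]
      exact ⟨lt_of_le_of_lt (supTailNorm_static_zero_le _ _ _ _ _)
          (ctNorm_profile_lt_top hα hα2 hr₁0 (fun m hm r hr ↦ hdf m (by omega) r (hr₁.trans hr))
            (fun ℓ hℓ r hr ↦ hBf ℓ (by omega) r (hr₁.trans hr))),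
        lt_of_le_of_lt (supTailNorm_static_zero_le _ _ _ _ _)
          (ctNorm_profile_lt_top hα hα2 hr₁0 (fun m hm r hr ↦ hdg m (by omega) r (hr₁.trans hr))
            (fun ℓ hℓ r hr ↦ hBg ℓ (by omega) r (hr₁.trans hr)))⟩
    | succ j =>
      rw [supTailNorm_static_succ, supTailNorm_static_succ]
      exact ⟨ENNReal.zero_lt_top, ENNReal.zero_lt_top⟩
  have hNs : ∀ r₁, r₀ < r₁ → (radial f g).sharpTailNormN α τ Tlo r₁ < ⊤ := by
    intro r₁ hr₁
    have hr₁0 : 0 < r₁ := hr₀.trans hr₁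
    rw [ADMTailTuple.sharpTailNormN, radial_lapseDev, radial_lamDev, radial_b_fun, radial_shift,
      show (radial f g).gammaDev = flat.gammaDev from rfl]
    refine ENNReal.sum_lt_top.mpr fun k _ ↦ ?_
    rw [supSharpTailNorm_of_vanish _ _ _ _ _ (flat_gammaDev_vanish hr₁0.le)]
    simp only [ENNReal.add_lt_top, supSharpTailNorm_zero_fun, add_zero]
    cases k with
    | zero =>
      simp only [Nat.cast_zero, add_zero]
      exact ⟨lt_of_le_of_lt (supSharpTailNorm_static_zero_le _ _ _ _ _)
          (ctSharpNorm_profile_lt_top hα hα2 hr₁0 (fun m hm r hr ↦ hdf m hm r (hr₁.trans hr))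
            (fun ℓ hℓ r hr ↦ hBf ℓ hℓ r (hr₁.trans hr))),
        lt_of_le_of_lt (supSharpTailNorm_static_zero_le _ _ _ _ _)
          (ctSharpNorm_profile_lt_top hα hα2 hr₁0 (fun m hm r hr ↦ hdg m hm r (hr₁.trans hr))
            (fun ℓ hℓ r hr ↦ hBg ℓ hℓ r (hr₁.trans hr)))⟩
    | succ k =>
      rw [supSharpTailNorm_static_succ, supSharpTailNorm_static_succ]
      exact ⟨ENNReal.zero_lt_top, ENNReal.zero_lt_top⟩
  refine ⟨⟨radial_isWellFormedOn _ _ hr₀.le Tlo, fun r₁ hr₁ ↦ ⟨hN r₁ hr₁, ?_, fun T ↦ ?_⟩⟩,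
    fun r₁ hr₁ ↦ hNs r₁ hr₁⟩
  · exact radial_isTailNondegenerate _ _ (hr₀.le.trans hr₁.le) hδ hϑ
      (fun r hr ↦ hg r (hr₁.trans hr)) (fun r hr ↦ hf r (hr₁.trans hr)) Tlo
  · exact radial_hasFiniteForcingTail _ _ (hr₀.le.trans hr₁.le) (fun ρ hρ ↦ hgd ρ (hr₁.trans hρ)) Tlo T

end GenericProfile

end Literature.Geometry.Lorentzian.TailClassModel

end
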